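import Literature.Analysis.FluidPDE.PlanarJunctionAgreement
import HarnessLib

/-!
# Re-descriptions: two frozen phases describing the same keyframe give the same fields

Topic `Literature/Analysis/FluidPDE`. Level-4 data model, part 6 (after `PlanarJunctionAgreement.lean`).
Consecutive phases of an explicit generator move are glued on the flat windows of their clocks
(`QuasiSelfSimilarGeneratorPhases.IsGeneratorMoveOn.glue_Icc` needs `Θ₁ t = Θ₂ t` and
`V₁ t = V₂ t` as functions on the whole plane for `t` near the junction time). The phase that ends
and the phase that starts describe the same keyframe curve, but in general by DIFFERENT chains
(a thin run that has grown is re-split into three sub-elements before a flex site is born on it,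
dead sites disappear from the piece lists, births re-describe run pieces as diagonal bands). This
file reduces the equality of the two assembled fields at such a junction to a finite rational
certificate:

* **frozen instants.** On a flat window the clock of a phase is `0` or `1` (`endVal b`); there all
  rates vanish, so every element stream function, the assembled stream function and the assembled
  velocity are `0` (`stream_eq_zero_of_clockDeriv`, `velocity_eq_zero_of_clockDeriv`): the
  velocities of two phases agree on the common flat window for free.
* **pointwise evaluation of the assembled scalar** (`scalar_eq_elem`): by the cover of a checked
  phase (`cover_of_geomB`) and junction agreement, at a point of the closed unit square lying in
  the tube box and the band of element `k` the assembled scalar IS `Θ_k`; at a point in no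
  tube-box-and-band it is `0`; outside the closed square only the two end nodes contribute.
* **element equivalence** (`ElemQ.equivB`): two typed elements at clock values `b, b' ∈ {0, 1}`
  have the same scalar as soon as they have the same orientation, the same evaluated transverse
  line / displacement profile and the same evaluated material slope function — evaluated kink
  lists are compared after dropping the kinks of zero jump (a site at its birth or death instant is
  invisible as a function).
* **tube rectangles and chain covers** (`tubeRect`, `chainCoversB`): at a frozen instant the tube
  box of a node is a rational rectangle; the certificate lists, for every node `k` of one phase,
  nodes of the other phase with equivalent elements whose tube rectangles cover the tube rectangle
  of `k` along an axis.
* **the theorem** (`scalar_eq_of_redescribeB`): if both phases pass their geometric checks, their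
  junctions agree, the certificate `redescribeB` holds, and the two end nodes (gate stubs) are
  frozen-equal, then the assembled scalars coincide on the whole plane at any two times on the
  respective flat windows.

Folklore (bookkeeping of cut-offs and finite sums); no named facts. Infrastructure towards a
discharge of `acm_compatible_blocks` (`QuasiSelfSimilarCompatibleBlocks.lean`).

## References

* G. Alberti, G. Crippa, A. L. Mazzucato, *Exponential self-similar mixing by incompressible
  flows*, J. Amer. Math. Soc. 32 (2019), 445–490, §§7–8 (arXiv:1605.02090).
-/

noncomputable section

open Function Set Filter
open scoped Topology ContDiff

namespace Literature.Analysis.FluidPDE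

namespace PlanarKinematics

open Gluing

/-- The plane `ℝ²` as a Euclidean space. [folklore] -/
local notation "E²" => EuclideanSpace ℝ (Fin 2)

/-! ## Frozen instants: clock values `0` and `1` -/

/-- The clock value of an end: `1` for `b = true` (end of the phase), `0` for `b = false` (start). [folklore] -/
def endVal (b : Bool) : ℝ := if b then 1 else 0

/-- `endVal b ∈ [0, 1]`. [folklore] -/
theorem endVal_mem_Icc (b : Bool) : endVal b ∈ Icc (0 : ℝ) 1 := by
  cases b <;> simp [endVal]

namespace Aff

/-- The value of clock-affine data at an end. [folklore] -/
def atEnd (a : Aff) (b : Bool) : ℚ := if b then a.v1 else a.v0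

/-- Evaluation at an end is the end value. [folklore] -/
@[simp] theorem eval_endVal (a : Aff) (b : Bool) : a.eval (endVal b) = a.atEnd b := by
  cases b <;> simp [endVal, atEnd]

end Aff

/-! ## Evaluated kink lists and equivalence of profiles at frozen instants -/

namespace Kink

/-- The evaluated datum `(b, J, ℓ)` of a kink at an end. [folklore] -/
def frz (k : Kink) (e : Bool) : ℚ × ℚ × ℚ := (k.b.atEnd e, k.J.atEnd e, k.ℓ)

/-- The value of an evaluated kink datum. [folklore] -/
def valQ (q : ℚ × ℚ × ℚ) (u : ℝ) : ℝ := (q.2.1 : ℝ) * rampAt q.1 q.2.2 u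

/-- The slope of an evaluated kink datum. [folklore] -/
def duQ (q : ℚ × ℚ × ℚ) (u : ℝ) : ℝ := (q.2.1 : ℝ) * step ((u - q.1) / q.2.2)

/-- At an end the value of a kink is the value of its evaluated datum. [folklore] -/
theorem val_endVal (k : Kink) (e : Bool) (u : ℝ) : k.val (endVal e) u = valQ (k.frz e) u := by
  simp [Kink.val, valQ, frz]

/-- At an end the slope of a kink is the slope of its evaluated datum. [folklore] -/
theorem du_endVal (k : Kink) (e : Bool) (u : ℝ) : k.du (endVal e) u = duQ (k.frz e) u := by
  simp [Kink.du, Kink.arg, duQ, frz]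

end Kink

/-- A sum over a list is the sum over the sublist where the summand can be nonzero. [folklore] -/
theorem List.sum_map_eq_sum_map_filter {α : Type*} (f : α → ℝ) (p : α → Bool) (h : ∀ a, p a = false → f a = 0) :
    ∀ L : List α, (L.map f).sum = ((L.filter p).map f).sum := by
  intro L
  induction L with
  | nil => simp
  | cons a L ih =>
    cases hp : p a with
    | true => simp [hp, ih]
    | false => simp [hp, ih, h a hp]

namespace Pw

variable (F : Pw)

/-- **Evaluated kink list** at an end, kinks of zero jump dropped. [folklore] -/
def frzKinks (F : Pw) (e : Bool) : List (ℚ × ℚ × ℚ) :=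
  ((F.kinks.map fun k => k.frz e).filter fun q => decide (q.2.1 ≠ 0))

/-- **Same slope function at two ends** (rational test): equal evaluated base slopes and equal
evaluated kink lists modulo zero jumps. [folklore] -/
def sameSlopeB (F : Pw) (e : Bool) (F' : Pw) (e' : Bool) : Bool :=
  decide (F.s.atEnd e = F'.s.atEnd e') && decide (F.frzKinks e = F'.frzKinks e')

/-- **Same value function at two ends** (rational test): also equal evaluated intercepts. [folklore] -/
def sameValB (F : Pw) (e : Bool) (F' : Pw) (e' : Bool) : Bool :=
  decide (F.c.atEnd e = F'.c.atEnd e') && F.sameSlopeB e F' e'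

/-- The slope at an end from the evaluated kink list. [folklore] -/
theorem du_endVal (e : Bool) (u : ℝ) : F.du (endVal e) u = (F.s.atEnd e : ℝ) + ((F.frzKinks e).map fun q => Kink.duQ q u).sum := by
  rw [Pw.du, Aff.eval_endVal, frzKinks]
  congr 1
  rw [← List.sum_map_eq_sum_map_filter (fun q => Kink.duQ q u) (fun q => decide (q.2.1 ≠ 0))
    (fun q hq => by simp only [ne_eq, decide_eq_false_iff_not, Decidable.not_not] at hq; simp [Kink.duQ, hq]),
    List.map_map]
  exact congrArg List.sum (List.map_congr_left fun k _ => k.du_endVal e u)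

/-- The value at an end from the evaluated kink list. [folklore] -/
theorem val_endVal (e : Bool) (u : ℝ) :
    F.val (endVal e) u = (F.c.atEnd e : ℝ) + (F.s.atEnd e : ℝ) * u + ((F.frzKinks e).map fun q => Kink.valQ q u).sum := by
  rw [Pw.val, Aff.eval_endVal, Aff.eval_endVal, frzKinks]
  congr 1
  rw [← List.sum_map_eq_sum_map_filter (fun q => Kink.valQ q u) (fun q => decide (q.2.1 ≠ 0))
    (fun q hq => by simp only [ne_eq, decide_eq_false_iff_not, Decidable.not_not] at hq; simp [Kink.valQ, hq]),
    List.map_map]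
  exact congrArg List.sum (List.map_congr_left fun k _ => k.val_endVal e u)

variable {F}

/-- **Soundness of the slope test**: equal slope functions at the two ends. [folklore] -/
theorem du_eq_of_sameSlopeB {e : Bool} {F' : Pw} {e' : Bool} (h : F.sameSlopeB e F' e' = true) (u : ℝ) :
    F.du (endVal e) u = F'.du (endVal e') u := by
  simp only [sameSlopeB, Bool.and_eq_true, decide_eq_true_eq] at h
  rw [F.du_endVal, F'.du_endVal, h.1, h.2]

/-- **Soundness of the value test**: equal value functions at the two ends. [folklore] -/
theorem val_eq_of_sameValB {e : Bool} {F' : Pw} {e' : Bool} (h : F.sameValB e F' e' = true) (u : ℝ) :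
    F.val (endVal e) u = F'.val (endVal e') u := by
  simp only [sameValB, sameSlopeB, Bool.and_eq_true, decide_eq_true_eq] at h
  rw [F.val_endVal, F'.val_endVal, h.1, h.2.1, h.2.2]

end Pw

/-! ## Equivalence of typed elements at frozen instants -/

namespace ElemQ

/-- **Element equivalence at two ends** (rational test): same constructor and orientation, equal
evaluated transverse line (run) or displacement profile (diagonal band), equal evaluated material
slope function. Stream offsets and the material intercept are irrelevant for the scalar. [folklore] -/
def equivB : ElemQ → Bool → ElemQ → Bool → Bool
  | run r, e, run r', e' => decide (r.o = r'.o) && decide (r.y.atEnd e = r'.y.atEnd e') && r.Ξ.sameSlopeB e r'.Ξ e'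
  | dg d, e, dg d', e' => decide (d.o = d'.o) && d.T.sameValB e d'.T e' && d.Ξ.sameSlopeB e d'.Ξ e'
  | _, _, _, _ => false

/-- **Soundness of element equivalence**: at times where the two clocks take the two end values,
equivalent elements have the same scalar. [folklore] -/
theorem scalar_eq_of_equivB {e₁ e₂ : ElemQ} {b₁ b₂ : Bool} (h : equivB e₁ b₁ e₂ b₂ = true) (G : ℝ → ℝ)
    {t₀ τ t₀' τ' t t' : ℝ} (ht : clock t₀ τ t = endVal b₁) (ht' : clock t₀' τ' t' = endVal b₂) (z : E²) :
    e₁.scalar t₀ τ G t z = e₂.scalar t₀' τ' G t' z := by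
  cases e₁ with
  | run r =>
    cases e₂ with
    | run r' =>
      simp only [equivB, Bool.and_eq_true, decide_eq_true_eq] at h
      obtain ⟨⟨ho, hy⟩, hΞ⟩ := h
      simp only [ElemQ.scalar, RunQ.scalar, LinFrame.conjScalar_apply, runScalar_apply, RunQ.yF, Pw.cdu, ht, ht',
        Aff.eval_endVal, hy, ho, Pw.du_eq_of_sameSlopeB hΞ]
    | dg d' => simp [equivB] at h
  | dg d =>
    cases e₂ with
    | run r' => simp [equivB] at h
    | dg d' =>
      simp only [equivB, Bool.and_eq_true, decide_eq_true_eq] at h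
      obtain ⟨⟨ho, hT⟩, hΞ⟩ := h
      simp only [ElemQ.scalar, DgQ.scalar, LinFrame.conjScalar_apply, cornerScalar_apply, Pw.cval, Pw.cdu, ht, ht',
        ho, Pw.val_eq_of_sameValB hT, Pw.du_eq_of_sameSlopeB hΞ]

end ElemQ

/-! ### Flipped frames (valley ≡ tent) and gap-regime equivalence (straight diagonal band ≡ run)

Births describe the second corner of a jog as a VALLEY kink in the first corner's frame; the
standard description of that corner is a TENT in its own frame, which is the first frame composed
with the flip `(x', y') ↦ (-y', -x')` (`u ↦ u`, `v ↦ -v`); for an even profile the two scalars are the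
same function. A diagonal band whose profile is straight on a region is, there, a run; more
generally two elements in gap regimes with proportional closed forms have the same scalar on the
region — the scalar half of the junction test, evaluated at the two frozen instants. -/

/-- The frame code of the flipped frame `F ∘ A_o`, `F (x', y') = (-y', -x')`. [folklore] -/
def flipCode (o : Fin 8) : Fin 8 := ![4, 5, 6, 7, 0, 1, 2, 3] o

/-- The flipped frame map. [folklore] -/
theorem d4Frame_flipCode_app (o : Fin 8) (z : E²) :
    (d4Frame (flipCode o)).app z = vec2 (-(((d4Frame o).app z) 1)) (-(((d4Frame o).app z) 0)) := by
  fin_cases o <;>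
    simp [flipCode, d4Frame, LinFrame.app_apply, d4a, d4b, d4c, d4d, vec2_apply_zero, vec2_apply_one]

namespace Pw

/-- **Negated frozen profile data**: intercept, slope and every jump negated. [folklore] -/
def negFrzB (F : Pw) (e : Bool) (F' : Pw) (e' : Bool) : Bool :=
  decide (F'.c.atEnd e' = -F.c.atEnd e) && decide (F'.s.atEnd e' = -F.s.atEnd e) &&
    decide (F'.frzKinks e' = (F.frzKinks e).map fun q => (q.1, -q.2.1, q.2.2))

/-- The value of negated profile data is the negated value. [folklore] -/
theorem val_eq_neg_of_negFrzB {F F' : Pw} {e e' : Bool} (h : F.negFrzB e F' e' = true) (u : ℝ) :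
    F'.val (endVal e') u = -F.val (endVal e) u := by
  simp only [negFrzB, Bool.and_eq_true, decide_eq_true_eq] at h
  obtain ⟨⟨hc, hs⟩, hk⟩ := h
  rw [F.val_endVal, F'.val_endVal, hc, hs, hk, List.map_map]
  have : ((F.frzKinks e).map ((fun q => Kink.valQ q u) ∘ fun q => (q.1, -q.2.1, q.2.2))).sum =
      -((F.frzKinks e).map fun q => Kink.valQ q u).sum := by
    induction F.frzKinks e with
    | nil => simp
    | cons q L ih =>
      rw [List.map_cons, List.map_cons, List.sum_cons, List.sum_cons, ih]
      simp only [Function.comp_apply, Kink.valQ]; push_cast; ring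
  rw [this]; push_cast; ring

end Pw

namespace ElemQ

/-- **Flip equivalence** (rational test): both diagonal bands, frame codes related by the flip,
displacement profile data negated, material slope function the same. [folklore] -/
def flipB : ElemQ → Bool → ElemQ → Bool → Bool
  | dg d, e, dg d', e' => decide (d'.o = flipCode d.o) && d.T.negFrzB e d'.T e' && d.Ξ.sameSlopeB e d'.Ξ e'
  | _, _, _, _ => false

/-- **Soundness of the flip equivalence** for an even profile. [folklore] -/
theorem scalar_eq_of_flipB {e₁ e₂ : ElemQ} {b₁ b₂ : Bool} (h : flipB e₁ b₁ e₂ b₂ = true) {G : ℝ → ℝ}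
    (hGe : ∀ x, G (-x) = G x) {t₀ τ t₀' τ' t t' : ℝ} (ht : clock t₀ τ t = endVal b₁) (ht' : clock t₀' τ' t' = endVal b₂)
    (z : E²) : e₁.scalar t₀ τ G t z = e₂.scalar t₀' τ' G t' z := by
  cases e₁ with
  | run r => simp [flipB] at h
  | dg d =>
    cases e₂ with
    | run r' => simp [flipB] at h
    | dg d' =>
      simp only [flipB, Bool.and_eq_true, decide_eq_true_eq] at h
      obtain ⟨⟨ho, hT⟩, hΞ⟩ := h
      simp only [ElemQ.scalar, DgQ.scalar, LinFrame.conjScalar_apply, cornerScalar_apply, Pw.cval, Pw.cdu, ht, ht', ho,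
        d4Frame_flipCode_app, vec2_apply_zero, vec2_apply_one]
      rw [Pw.val_eq_neg_of_negFrzB hT, ← Pw.du_eq_of_sameSlopeB hΞ]
      have e1 : -((d4Frame d.o).app z) 1 - -((d4Frame d.o).app z) 0 = ((d4Frame d.o).app z) 0 - ((d4Frame d.o).app z) 1 := by ring
      rw [e1, ← hGe]
      congr 1
      rw [← neg_div]
      congr 1
      ring

end ElemQ

/-! #### Frozen elements: constant data, zero-jump kinks dropped

A birth element at its initial instant has a zero-jump kink in the middle of its box: as a function
it is straight, but the gap bookkeeping sees the kink. Freezing the data at the end (all affine data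
constant, zero-jump kinks removed) gives an element with the same scalar at that instant and honest
gaps. -/

namespace Kink

/-- A kink frozen at an end (constant data). [folklore] -/
def frzK (k : Kink) (e : Bool) : Kink := ⟨Aff.const (k.b.atEnd e), Aff.const (k.J.atEnd e), k.ℓ⟩

/-- The frozen datum of a frozen kink is the frozen datum. [folklore] -/
@[simp] theorem frz_frzK (k : Kink) (e e' : Bool) : (k.frzK e).frz e' = k.frz e := by
  cases e' <;> simp [frzK, Kink.frz, Aff.atEnd, Aff.const]

end Kink

namespace Pw

/-- **Frozen profile**: constant intercept and slope, the kinks of nonzero jump frozen. [folklore] -/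
def frzPw (F : Pw) (e : Bool) : Pw :=
  ⟨Aff.const (F.c.atEnd e), Aff.const (F.s.atEnd e), (F.kinks.filter fun k => decide (k.J.atEnd e ≠ 0)).map fun k => k.frzK e⟩

/-- The frozen kink list of the frozen profile is the frozen kink list. [folklore] -/
theorem frzKinks_frzPw (F : Pw) (e e' : Bool) : (F.frzPw e).frzKinks e' = F.frzKinks e := by
  simp only [Pw.frzKinks, frzPw, List.map_map, List.filter_map]
  have h1 : ((fun q : ℚ × ℚ × ℚ => decide (q.2.1 ≠ 0)) ∘ (fun k : Kink => k.frz e') ∘ fun k : Kink => k.frzK e) =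
      fun k : Kink => decide (k.J.atEnd e ≠ 0) := by
    funext k; cases e' <;> simp [Function.comp_apply, Kink.frz, Kink.frzK, Aff.atEnd, Aff.const]
  have h2 : ((fun q : ℚ × ℚ × ℚ => decide (q.2.1 ≠ 0)) ∘ fun k : Kink => k.frz e) = fun k : Kink => decide (k.J.atEnd e ≠ 0) := by
    funext k; simp [Function.comp_apply, Kink.frz]
  rw [h1, h2, List.filter_filter]
  simp only [Bool.and_self]
  refine List.map_congr_left fun k _ => ?_
  simp [Function.comp_apply]

/-- The frozen profile has the same value data at any end. [folklore] -/
theorem sameValB_frzPw (F : Pw) (e e' : Bool) : F.sameValB e (F.frzPw e) e' = true := by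
  have hk := F.frzKinks_frzPw e e'
  simp only [Pw.sameValB, Pw.sameSlopeB, Bool.and_eq_true, decide_eq_true_eq]
  refine ⟨?_, ?_, hk.symm⟩
  · cases e' <;> simp [frzPw, Aff.atEnd, Aff.const]
  · cases e' <;> simp [frzPw, Aff.atEnd, Aff.const]

/-- The frozen profile has the same slope data at any end. [folklore] -/
theorem sameSlopeB_frzPw (F : Pw) (e e' : Bool) : F.sameSlopeB e (F.frzPw e) e' = true := by
  have := F.sameValB_frzPw e e'
  simp only [Pw.sameValB, Bool.and_eq_true] at this
  exact this.2

/-- Value-data agreement passes to the frozen profiles. [folklore] -/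
theorem sameValB_frzPw_frzPw {F F' : Pw} {e e' : Bool} (h : F.sameValB e F' e' = true) :
    (F.frzPw e).sameValB e (F'.frzPw e') e' = true := by
  have hc : ∀ (G : Pw) (b b' : Bool), (G.frzPw b).c.atEnd b' = G.c.atEnd b := fun G b b' => by
    cases b <;> cases b' <;> simp [frzPw, Aff.atEnd, Aff.const]
  have hs : ∀ (G : Pw) (b b' : Bool), (G.frzPw b).s.atEnd b' = G.s.atEnd b := fun G b b' => by
    cases b <;> cases b' <;> simp [frzPw, Aff.atEnd, Aff.const]
  simp only [Pw.sameValB, Pw.sameSlopeB, Bool.and_eq_true, decide_eq_true_eq, hc, hs, Pw.frzKinks_frzPw] at h ⊢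
  tauto

end Pw

namespace ElemQ

/-- **Frozen element** at an end (offsets dropped: irrelevant for the scalar). [folklore] -/
def frz : ElemQ → Bool → ElemQ
  | run r, e => run ⟨r.o, Aff.const (r.y.atEnd e), r.Ξ.frzPw e, r.wlo, r.whi, Aff.const 0, Aff.const 0⟩
  | dg d, e => dg ⟨d.o, d.T.frzPw e, d.Ξ.frzPw e, d.wlo, d.whi, Aff.const 0, Aff.const 0⟩

/-- An element is equivalent to its frozen version (at any end of the latter). [folklore] -/
theorem equivB_frz (e₁ : ElemQ) (b b' : Bool) : equivB e₁ b (e₁.frz b) b' = true := by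
  cases e₁ with
  | run r =>
    have h := r.Ξ.sameSlopeB_frzPw b b'
    cases b' <;> simp [frz, equivB, h, Aff.atEnd, Aff.const]
  | dg d =>
    have h1 := d.T.sameValB_frzPw b b'
    have h2 := d.Ξ.sameSlopeB_frzPw b b'
    simp [frz, equivB, h1, h2]

/-- **The frozen element has the same scalar at the instant** (evaluated with the same clock). [folklore] -/
theorem scalar_frz (e₁ : ElemQ) (b : Bool) (G : ℝ → ℝ) {t₀ τ t : ℝ} (ht : clock t₀ τ t = endVal b) (z : E²) :
    (e₁.frz b).scalar t₀ τ G t z = e₁.scalar t₀ τ G t z :=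
  (scalar_eq_of_equivB (e₁.equivB_frz b b) G ht ht z).symm

end ElemQ

/-! #### Gap-regime equivalence at two frozen instants -/

namespace Poly

/-- Rational Horner evaluation. [folklore] -/
def evalQ : Poly → ℚ → ℚ
  | [], _ => 0
  | c :: p, q => c + q * evalQ p q

/-- Real evaluation at a rational point is the rational evaluation. [folklore] -/
theorem eval_ratCast : ∀ (p : Poly) (q : ℚ), eval p (q : ℝ) = (evalQ p q : ℝ)
  | [], q => by simp [evalQ]
  | c :: p, q => by rw [eval_cons, evalQ, eval_ratCast p q]; push_cast; ring

/-- Evaluation at an end. [folklore] -/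
def atEnd (p : Poly) (b : Bool) : ℚ := evalQ p (if b then 1 else 0)

/-- Real evaluation at an end value. [folklore] -/
theorem eval_endVal (p : Poly) (b : Bool) : eval p (endVal b) = (p.atEnd b : ℝ) := by
  rw [atEnd, ← eval_ratCast]; cases b <;> simp [endVal]

end Poly

namespace Lin

/-- **Frozen linear form**: the three coefficients evaluated at an end. [folklore] -/
def frz (L : Lin) (b : Bool) : ℚ × ℚ × ℚ := (L.k0.atEnd b, L.k1.atEnd b, L.k2.atEnd b)

/-- Evaluation at an end from the frozen coefficients. [folklore] -/
theorem eval_endVal (L : Lin) (b : Bool) (z : E²) :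
    L.eval (endVal b) z = ((L.frz b).1 : ℝ) + ((L.frz b).2.1 : ℝ) * z 0 + ((L.frz b).2.2 : ℝ) * z 1 := by
  simp [Lin.eval, Lin.frz, Poly.eval_endVal]

end Lin

/-- Scaling a frozen linear form. [folklore] -/
def frzSmul (c : ℚ) (q : ℚ × ℚ × ℚ) : ℚ × ℚ × ℚ := (c * q.1, c * q.2.1, c * q.2.2)

namespace Pw

/-- **Gap regime at an end** (rational test) for the `u`-interval `[ua, ub]`. [folklore] -/
def gapAtEndB (F : Pw) (m : ℕ) (e : Bool) (ua ub : ℚ) : Bool :=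
  ((F.kinks.take m).all fun k => decide (k.b.atEnd e + 2 * k.ℓ / 3 ≤ ua)) &&
    ((F.kinks.drop m).all fun k => decide (ub ≤ k.b.atEnd e + k.ℓ / 3))

/-- Soundness: every abscissa of the interval is in the gap at the end value. [folklore] -/
theorem inGap_of_gapAtEndB {F : Pw} {m : ℕ} {e : Bool} {ua ub : ℚ} (h : F.gapAtEndB m e ua ub = true) {u : ℝ}
    (hu : (ua : ℝ) ≤ u ∧ u ≤ ub) : F.InGap m (endVal e) u := by
  simp only [gapAtEndB, Bool.and_eq_true, List.all_eq_true, decide_eq_true_eq] at h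
  refine ⟨fun k hk => ?_, fun k hk => ?_⟩
  · have := h.1 k hk
    rw [Aff.eval_endVal]
    have h' : ((k.b.atEnd e + 2 * k.ℓ / 3 : ℚ) : ℝ) ≤ ua := by exact_mod_cast this
    push_cast at h'; linarith [hu.1]
  · have := h.2 k hk
    rw [Aff.eval_endVal]
    have h' : ((ub : ℚ) : ℝ) ≤ k.b.atEnd e + k.ℓ / 3 := by exact_mod_cast this
    linarith [hu.2]

end Pw

namespace Pw

/-- **Transition regime of kink `m`** at `(α, u)`: the first `m` kinks passed, the kinks after `m`
not begun (kink `m` itself unrestricted). [folklore] -/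
def InTrans (F : Pw) (m : ℕ) (α u : ℝ) : Prop :=
  (∀ k ∈ F.kinks.take m, k.b.eval α + 2 * k.ℓ / 3 ≤ u) ∧ (∀ k ∈ F.kinks.drop (m + 1), u ≤ k.b.eval α + k.ℓ / 3)

/-- **In the transition regime of kink `m` the slope is `W m + (kink m).du`.** [folklore] -/
theorem du_eq_trans {F : Pw} (hF : F.LenPos) {m : ℕ} {α u : ℝ} (h : F.InTrans m α u) {km : Kink}
    (hkm : F.kinks[m]? = some km) : F.du α u = F.W m α + km.du α u := by
  have hm : m < F.kinks.length := (List.getElem?_eq_some_iff.1 hkm).1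
  have hsplit : F.kinks = F.kinks.take m ++ km :: F.kinks.drop (m + 1) := by
    have := (List.getElem?_eq_some_iff.1 hkm).2
    rw [← this, List.getElem_cons_drop, List.take_append_drop]
  rw [Pw.du, Pw.W]
  conv_lhs => rw [hsplit]
  rw [List.map_append, List.sum_append, List.map_cons, List.sum_cons]
  have h0 : ((F.kinks.drop (m + 1)).map fun k => k.du α u).sum = 0 :=
    List.sum_eq_zero fun x hx => by
      obtain ⟨k, hk, rfl⟩ := List.mem_map.1 hx
      exact k.du_of_le (hF k (List.mem_of_mem_drop hk)) (h.2 k hk)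
  have h1 : ((F.kinks.take m).map fun k => k.du α u).sum = ((F.kinks.take m).map fun k => k.J.eval α).sum :=
    congrArg List.sum (List.map_congr_left fun k hk => k.du_of_ge (hF k (List.mem_of_mem_take hk)) (h.1 k hk))
  rw [h0, h1]; ring

/-- **Transition regime at an end** (rational test) on `[ua, ub]`. [folklore] -/
def transAtEndB (F : Pw) (m : ℕ) (e : Bool) (ua ub : ℚ) : Bool :=
  ((F.kinks.take m).all fun k => decide (k.b.atEnd e + 2 * k.ℓ / 3 ≤ ua)) &&
    ((F.kinks.drop (m + 1)).all fun k => decide (ub ≤ k.b.atEnd e + k.ℓ / 3))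

/-- Soundness of the transition regime test. [folklore] -/
theorem inTrans_of_transAtEndB {F : Pw} {m : ℕ} {e : Bool} {ua ub : ℚ} (h : F.transAtEndB m e ua ub = true) {u : ℝ}
    (hu : (ua : ℝ) ≤ u ∧ u ≤ ub) : F.InTrans m (endVal e) u := by
  simp only [transAtEndB, Bool.and_eq_true, List.all_eq_true, decide_eq_true_eq] at h
  refine ⟨fun k hk => ?_, fun k hk => ?_⟩
  · have := h.1 k hk
    rw [Aff.eval_endVal]
    have h' : ((k.b.atEnd e + 2 * k.ℓ / 3 : ℚ) : ℝ) ≤ ua := by exact_mod_cast this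
    push_cast at h'; linarith [hu.1]
  · have := h.2 k hk
    rw [Aff.eval_endVal]
    have h' : ((ub : ℚ) : ℝ) ≤ k.b.atEnd e + k.ℓ / 3 := by exact_mod_cast this
    linarith [hu.2]

/-- **Same local material data** at kink `m` of `F` (end `e`) and kink `m'` of `F'` (end `e'`):
equal gap slopes before the kink and equal frozen kink data. [folklore] -/
def sameLocalB (F : Pw) (m : ℕ) (e : Bool) (F' : Pw) (m' : ℕ) (e' : Bool) : Bool :=
  decide ((F.WAff m).atEnd e = (F'.WAff m').atEnd e') &&
    match F.kinks[m]?, F'.kinks[m']? with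
    | some k, some k' => decide (k.frz e = k'.frz e')
    | _, _ => false

/-- A kink's slope at the end value depends only on its frozen data. [folklore] -/
theorem du_eq_of_frz_eq {k k' : Kink} {e e' : Bool} (h : k.frz e = k'.frz e') (u : ℝ) :
    k.du (endVal e) u = k'.du (endVal e') u := by
  simp only [Kink.frz, Prod.mk.injEq] at h
  obtain ⟨hb, hJ, hℓ⟩ := h
  simp only [Kink.du, Kink.arg, Aff.eval_endVal, hb, hJ, hℓ]

/-- **Soundness of the local data test**: equal slopes in the two transition regimes. [folklore] -/
theorem du_eq_of_sameLocalB {F F' : Pw} {m m' : ℕ} {e e' : Bool} (h : F.sameLocalB m e F' m' e' = true)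
    (hF : F.LenPos) (hF' : F'.LenPos) {u u' : ℝ} (huu : u = u') (h1 : F.InTrans m (endVal e) u)
    (h2 : F'.InTrans m' (endVal e') u') : F.du (endVal e) u = F'.du (endVal e') u' := by
  subst huu
  unfold sameLocalB at h
  cases hk : F.kinks[m]? with
  | none => rw [hk] at h; simp at h
  | some k =>
    cases hk' : F'.kinks[m']? with
    | none => rw [hk, hk'] at h; simp at h
    | some k' =>
      rw [hk, hk'] at h
      simp only [Bool.and_eq_true, decide_eq_true_eq] at h
      obtain ⟨hW, hkk⟩ := h
      rw [Pw.du_eq_trans hF h1 hk, Pw.du_eq_trans hF' h2 hk', ← F.eval_WAff, ← F'.eval_WAff, Aff.eval_endVal,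
        Aff.eval_endVal, hW, du_eq_of_frz_eq hkk]

/-- **Mirrored local material data** at kink `m` of `F` (end `e`) and kink `m'` of `F'` (end `e'`),
for a covering element whose frame abscissa is REVERSED (`u' = -u`, e.g. a gate stub re-described
from its gate, or a child element pulled back through an orientation-reversing similarity): the gap
slope of `F'` before its kink is the gap slope of `F` after its kink, and the frozen kink of `F'` is
the mirror image `(-b - ℓ, -J, ℓ)` of the frozen kink of `F`. [folklore] -/
def revLocalB (F : Pw) (m : ℕ) (e : Bool) (F' : Pw) (m' : ℕ) (e' : Bool) : Bool :=
  match F.kinks[m]?, F'.kinks[m']? with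
  | some k, some k' =>
    decide ((F'.WAff m').atEnd e' = (F.WAff m).atEnd e + k.J.atEnd e) &&
      decide (k'.frz e' = (-(k.b.atEnd e) - k.ℓ, -(k.J.atEnd e), k.ℓ))
  | _, _ => false

/-- **A mirrored kink has the mirrored slope**: `k'.du (-u) = -J + k.du u` (symmetry of the smooth
step about `1/2`). [folklore] -/
theorem du_neg_of_frz_mirror {k k' : Kink} {e e' : Bool}
    (h : k'.frz e' = (-(k.b.atEnd e) - k.ℓ, -(k.J.atEnd e), k.ℓ)) (hℓ : (k.ℓ : ℝ) ≠ 0) (u : ℝ) :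
    k'.du (endVal e') (-u) = -(k.J.atEnd e : ℝ) + k.du (endVal e) u := by
  simp only [Kink.frz, Prod.mk.injEq] at h
  obtain ⟨hb, hJ, hℓ'⟩ := h
  simp only [Kink.du, Kink.arg, Aff.eval_endVal, hb, hJ, hℓ']
  have e1 : (-u - ((-(k.b.atEnd e) - k.ℓ : ℚ) : ℝ)) / (k.ℓ : ℝ) = 1 - (u - (k.b.atEnd e : ℝ)) / k.ℓ := by
    push_cast; field_simp; ring
  rw [e1, step_one_sub]; push_cast; ring

/-- **Soundness of the mirrored local data test**: equal slopes at `u` and `u' = -u` in the two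
transition regimes. [folklore] -/
theorem du_eq_of_revLocalB {F F' : Pw} {m m' : ℕ} {e e' : Bool} (h : F.revLocalB m e F' m' e' = true)
    (hF : F.LenPos) (hF' : F'.LenPos) {u u' : ℝ} (huu : u' = -u) (h1 : F.InTrans m (endVal e) u)
    (h2 : F'.InTrans m' (endVal e') u') : F.du (endVal e) u = F'.du (endVal e') u' := by
  subst huu
  unfold revLocalB at h
  cases hk : F.kinks[m]? with
  | none => rw [hk] at h; simp at h
  | some k =>
    cases hk' : F'.kinks[m']? with
    | none => rw [hk, hk'] at h; simp at h
    | some k' =>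
      rw [hk, hk'] at h
      simp only [Bool.and_eq_true, decide_eq_true_eq] at h
      obtain ⟨hW, hkk⟩ := h
      have hℓ : (k.ℓ : ℝ) ≠ 0 := (hF k (List.mem_of_getElem? hk)).ne'
      rw [Pw.du_eq_trans hF h1 hk, Pw.du_eq_trans hF' h2 hk', ← F.eval_WAff, ← F'.eval_WAff, Aff.eval_endVal,
        Aff.eval_endVal, hW, du_neg_of_frz_mirror hkk hℓ]
      push_cast; ring

end Pw

namespace ElemQ

/-- **Gap side check at an end**: line regime (for a diagonal band: gap `mT` of `T`) and material
gap `mΞ` valid on `[ua, ub]` at end `e`, `mΞ` a gap index. [folklore] -/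
def gapSideB (e₁ : ElemQ) (b : Bool) (mT mΞ : ℕ) (ua ub : ℚ) : Bool :=
  (match e₁ with
    | run _ => true
    | dg d => d.T.gapAtEndB mT b ua ub) &&
    e₁.xi.gapAtEndB mΞ b ua ub && decide (mΞ ≤ e₁.xi.kinks.length)

/-- Gap side soundness: the line gap and the material gap at the end value. [folklore] -/
theorem gaps_of_gapSideB {e₁ : ElemQ} {b : Bool} {mT mΞ : ℕ} {ua ub : ℚ} (h : e₁.gapSideB b mT mΞ ua ub = true)
    {u : ℝ} (hu : (ua : ℝ) ≤ u ∧ u ≤ ub) :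
    e₁.LineGap mT (endVal b) u ∧ e₁.xi.InGap mΞ (endVal b) u ∧ mΞ ≤ e₁.xi.kinks.length := by
  simp only [gapSideB, Bool.and_eq_true, decide_eq_true_eq] at h
  obtain ⟨⟨hT, hΞ⟩, hm⟩ := h
  refine ⟨?_, Pw.inGap_of_gapAtEndB hΞ hu, hm⟩
  cases e₁ with
  | run r => trivial
  | dg d => exact Pw.inGap_of_gapAtEndB hT hu

end ElemQ

/-- **Equivalence certificate** of a cover entry: plain (same data), flipped frames, or gap regimes
with the two `u`-intervals. [folklore] -/
inductive EquivCert
  /-- same constructor, orientation and frozen data -/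
  | same
  /-- diagonal bands in flipped frames with negated displacement data -/
  | flip
  /-- gap regimes of the FROZEN elements: the covered node's `mT, mΞ` on the piece interval, the
  covering node's `mT', mΞ'` on the abscissa interval `[ua', ub']` -/
  | gap (mT mΞ mT' mΞ' : ℕ) (ua' ub' : ℚ)
  /-- same shape (frozen line data), the FROZEN material profiles in the transition regime of ONE
  kink (`mΞ` of the covered, `mΞ'` of the covering element) with the same local data, on the piece
  interval resp. on `[ua', ub']` -/
  | localXi (mΞ mΞ' : ℕ) (ua' ub' : ℚ)
deriving DecidableEq, Inhabited

namespace ElemQ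

/-! ## Streams vanish at flat clock times -/

/-- **At a time where the clock rate vanishes, the stream function of a typed element is `0`.** [folklore] -/
theorem stream_eq_zero_of_clockDeriv (e : ElemQ) {t₀ τ t : ℝ} (h : clockDeriv t₀ τ t = 0) (z : E²) :
    e.stream t₀ τ t z = 0 := by
  cases e with
  | run r =>
    simp [ElemQ.stream, RunQ.stream, LinFrame.conjStream_apply, runStream, graphStream, axialRate, RunQ.y'F, Pw.cdt,
      streamOffset, h]
  | dg d =>
    simp [ElemQ.stream, DgQ.stream, LinFrame.conjStream_apply, cornerStream, graphStream, DgQ.g, axialRate, Pw.cdt,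
      Pw.cprim, streamOffset, h]

end ElemQ

/-! ## Tube rectangles at frozen instants -/

/-- A linear function of two variables on a rectangle lies between its extreme corner values. [folklore] -/
theorem linear_mem_of_corners {a b x y x0 x1 y0 y1 lo hi : ℝ} (hx : x0 ≤ x ∧ x ≤ x1) (hy : y0 ≤ y ∧ y ≤ y1)
    (h1 : lo ≤ a * x0 + b * y0 ∧ a * x0 + b * y0 ≤ hi) (h2 : lo ≤ a * x0 + b * y1 ∧ a * x0 + b * y1 ≤ hi)
    (h3 : lo ≤ a * x1 + b * y0 ∧ a * x1 + b * y0 ≤ hi) (h4 : lo ≤ a * x1 + b * y1 ∧ a * x1 + b * y1 ≤ hi) :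
    lo ≤ a * x + b * y ∧ a * x + b * y ≤ hi := by
  -- `a x` is between `a x0` and `a x1`, `b y` between `b y0` and `b y1`
  have hax : min (a * x0) (a * x1) ≤ a * x ∧ a * x ≤ max (a * x0) (a * x1) := by
    rcases le_total 0 a with ha | ha
    · exact ⟨(min_le_left _ _).trans (mul_le_mul_of_nonneg_left hx.1 ha),
        (mul_le_mul_of_nonneg_left hx.2 ha).trans (le_max_right _ _)⟩
    · exact ⟨(min_le_right _ _).trans (mul_le_mul_of_nonpos_left hx.2 ha),
        (mul_le_mul_of_nonpos_left hx.1 ha).trans (le_max_left _ _)⟩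
  have hby : min (b * y0) (b * y1) ≤ b * y ∧ b * y ≤ max (b * y0) (b * y1) := by
    rcases le_total 0 b with hb | hb
    · exact ⟨(min_le_left _ _).trans (mul_le_mul_of_nonneg_left hy.1 hb),
        (mul_le_mul_of_nonneg_left hy.2 hb).trans (le_max_right _ _)⟩
    · exact ⟨(min_le_right _ _).trans (mul_le_mul_of_nonpos_left hy.2 hb),
        (mul_le_mul_of_nonpos_left hy.1 hb).trans (le_max_left _ _)⟩
  constructor
  · have : lo ≤ min (a * x0) (a * x1) + min (b * y0) (b * y1) := by
      rcases min_choice (a * x0) (a * x1) with h | h <;> rcases min_choice (b * y0) (b * y1) with h' | h' <;>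
        rw [h, h'] <;> linarith [h1.1, h2.1, h3.1, h4.1]
    linarith [hax.1, hby.1]
  · have : max (a * x0) (a * x1) + max (b * y0) (b * y1) ≤ hi := by
      rcases max_choice (a * x0) (a * x1) with h | h <;> rcases max_choice (b * y0) (b * y1) with h' | h' <;>
        rw [h, h'] <;> linarith [h1.2, h2.2, h3.2, h4.2]
    linarith [hax.2, hby.2]

/-- **Rational rectangle** `[lo 0, hi 0] × [lo 1, hi 1]`. [folklore] -/
structure RectQ where
  /-- lower corner -/
  lo : Fin 2 → ℚ
  /-- upper corner -/
  hi : Fin 2 → ℚ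

namespace RectQ

/-- Membership in a rational rectangle. [folklore] -/
def mem (R : RectQ) (z : E²) : Prop := ∀ i, (R.lo i : ℝ) ≤ z i ∧ z i ≤ R.hi i

/-- Intersection with a lower bound along an axis. [folklore] -/
def clipLo (R : RectQ) (i : Fin 2) (c : ℚ) : RectQ := ⟨fun j => if j = i then max (R.lo j) c else R.lo j, R.hi⟩

/-- Intersection with an upper bound along an axis. [folklore] -/
def clipHi (R : RectQ) (i : Fin 2) (c : ℚ) : RectQ := ⟨R.lo, fun j => if j = i then min (R.hi j) c else R.hi j⟩

/-- Membership in a lower clip. [folklore] -/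
theorem mem_clipLo (R : RectQ) (i : Fin 2) (c : ℚ) (z : E²) : (R.clipLo i c).mem z ↔ R.mem z ∧ (c : ℝ) ≤ z i := by
  constructor
  · intro h
    refine ⟨fun j => ⟨?_, (h j).2⟩, ?_⟩
    · have := (h j).1; simp only [clipLo] at this
      split_ifs at this with hj
      · push_cast at this; exact le_trans (le_max_left _ _) this
      · exact this
    · have := (h i).1; simp only [clipLo, if_true] at this; push_cast at this
      exact le_trans (le_max_right _ _) this
  · rintro ⟨h, hc⟩ j
    refine ⟨?_, (h j).2⟩
    simp only [clipLo]
    split_ifs with hj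
    · subst hj; push_cast; exact max_le (h j).1 hc
    · exact (h j).1

/-- Membership in an upper clip. [folklore] -/
theorem mem_clipHi (R : RectQ) (i : Fin 2) (c : ℚ) (z : E²) : (R.clipHi i c).mem z ↔ R.mem z ∧ z i ≤ (c : ℝ) := by
  constructor
  · intro h
    refine ⟨fun j => ⟨(h j).1, ?_⟩, ?_⟩
    · have := (h j).2; simp only [clipHi] at this
      split_ifs at this with hj
      · push_cast at this; exact le_trans this (min_le_left _ _)
      · exact this
    · have := (h i).2; simp only [clipHi, if_true] at this; push_cast at this
      exact le_trans this (min_le_right _ _)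
  · rintro ⟨h, hc⟩ j
    refine ⟨(h j).1, ?_⟩
    simp only [clipHi]
    split_ifs with hj
    · subst hj; push_cast; exact le_min (h j).2 hc
    · exact (h j).2

/-- **Emptiness test** of a rational rectangle. [folklore] -/
def isEmptyB (R : RectQ) : Bool := decide (R.hi 0 < R.lo 0) || decide (R.hi 1 < R.lo 1)

/-- An empty rectangle has no points. [folklore] -/
theorem not_mem_of_isEmptyB {R : RectQ} (h : R.isEmptyB = true) (z : E²) : ¬ R.mem z := by
  intro hz
  simp only [isEmptyB, Bool.or_eq_true, decide_eq_true_eq] at h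
  rcases h with h | h
  · have := hz 0; have h' : (R.hi 0 : ℝ) < R.lo 0 := by exact_mod_cast h
    linarith [this.1, this.2]
  · have := hz 1; have h' : (R.hi 1 : ℝ) < R.lo 1 := by exact_mod_cast h
    linarith [this.1, this.2]

/-- **Chain cover test** along axis `i`: the rectangles `Rs` all contain `R` transversally, and
their `i`-intervals, in the listed order, start before `R` does, overlap or abut consecutively,
and the last one used reaches the end of `R`. [folklore] -/
def chainCoversAux (i : Fin 2) (tlo thi : ℚ) (a b : ℚ) : List RectQ → Bool
  | [] => false
  | S :: rest => decide (S.lo i ≤ a) && decide (S.lo (1 - i) ≤ tlo) && decide (thi ≤ S.hi (1 - i)) &&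
      (decide (b ≤ S.hi i) || chainCoversAux i tlo thi (S.hi i) b rest)

/-- **Chain cover test** of `R` by `Rs` along axis `i` (an empty `R` is always covered). [folklore] -/
def chainCoversB (R : RectQ) (i : Fin 2) (Rs : List RectQ) : Bool :=
  R.isEmptyB || chainCoversAux i (R.lo (1 - i)) (R.hi (1 - i)) (R.lo i) (R.hi i) Rs

/-- Soundness of the auxiliary chain cover. [folklore] -/
theorem exists_mem_of_chainCoversAux (i : Fin 2) (tlo thi : ℚ) :
    ∀ (Rs : List RectQ) (a b : ℚ), chainCoversAux i tlo thi a b Rs = true →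
      ∀ z : E², (a : ℝ) ≤ z i → z i ≤ (b : ℝ) → (tlo : ℝ) ≤ z (1 - i) → z (1 - i) ≤ (thi : ℝ) → ∃ S ∈ Rs, S.mem z := by
  intro Rs
  induction Rs with
  | nil => intro a b h; simp [chainCoversAux] at h
  | cons S rest ih =>
    intro a b h z ha hb htlo hthi
    simp only [chainCoversAux, Bool.and_eq_true, Bool.or_eq_true, decide_eq_true_eq] at h
    obtain ⟨⟨⟨h1, h2⟩, h3⟩, h4⟩ := h
    have h1' : (S.lo i : ℝ) ≤ a := by exact_mod_cast h1
    have h2' : (S.lo (1 - i) : ℝ) ≤ tlo := by exact_mod_cast h2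
    have h3' : (thi : ℝ) ≤ S.hi (1 - i) := by exact_mod_cast h3
    by_cases hzS : z i ≤ (S.hi i : ℝ)
    · refine ⟨S, by simp, fun j => ?_⟩
      by_cases hj : j = i
      · subst hj; exact ⟨h1'.trans ha, hzS⟩
      · have hj' : j = 1 - i := by fin_cases i <;> fin_cases j <;> simp_all
        subst hj'; exact ⟨h2'.trans htlo, hthi.trans h3'⟩
    · push Not at hzS
      rcases h4 with h4 | h4
      · have : (b : ℝ) ≤ S.hi i := by exact_mod_cast h4
        linarith
      · obtain ⟨S', hS', hmem⟩ := ih (S.hi i) b h4 z hzS.le hb htlo hthi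
        exact ⟨S', by simp [hS'], hmem⟩

/-- **Soundness of the chain cover**: every point of `R` lies in one of the `Rs`. [folklore] -/
theorem exists_mem_of_chainCoversB {R : RectQ} {i : Fin 2} {Rs : List RectQ} (h : R.chainCoversB i Rs = true)
    {z : E²} (hz : R.mem z) : ∃ S ∈ Rs, S.mem z := by
  simp only [chainCoversB, Bool.or_eq_true] at h
  rcases h with h | h
  · exact absurd hz (not_mem_of_isEmptyB h z)
  · exact exists_mem_of_chainCoversAux i _ _ Rs _ _ h z (hz i).1 (hz i).2 (hz (1 - i)).1 (hz (1 - i)).2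

/-- Intersection of two rectangles. [folklore] -/
def inter (R S : RectQ) : RectQ := ⟨fun j => max (R.lo j) (S.lo j), fun j => min (R.hi j) (S.hi j)⟩

/-- Membership in an intersection. [folklore] -/
theorem mem_inter {R S : RectQ} {z : E²} (hR : R.mem z) (hS : S.mem z) : (R.inter S).mem z := fun j => by
  simp only [inter]; push_cast
  exact ⟨max_le (hR j).1 (hS j).1, le_min (hR j).2 (hS j).2⟩

/-- **Containment test** `R ⊆ [0,1]²`-style: `R` inside another rectangle. [folklore] -/
def subsetB (R S : RectQ) : Bool := decide (S.lo 0 ≤ R.lo 0) && decide (R.hi 0 ≤ S.hi 0) && decide (S.lo 1 ≤ R.lo 1) && decide (R.hi 1 ≤ S.hi 1)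

/-- Soundness of the containment test. [folklore] -/
theorem mem_of_subsetB {R S : RectQ} (h : R.subsetB S = true) {z : E²} (hz : R.mem z) : S.mem z := by
  simp only [subsetB, Bool.and_eq_true, decide_eq_true_eq] at h
  obtain ⟨⟨⟨h1, h2⟩, h3⟩, h4⟩ := h
  have h1' : (S.lo 0 : ℝ) ≤ R.lo 0 := by exact_mod_cast h1
  have h2' : (R.hi 0 : ℝ) ≤ S.hi 0 := by exact_mod_cast h2
  have h3' : (S.lo 1 : ℝ) ≤ R.lo 1 := by exact_mod_cast h3
  have h4' : (R.hi 1 : ℝ) ≤ S.hi 1 := by exact_mod_cast h4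
  intro j
  match j with
  | 0 => exact ⟨h1'.trans (hz 0).1, (hz 0).2.trans h2'⟩
  | 1 => exact ⟨h3'.trans (hz 1).1, (hz 1).2.trans h4'⟩

/-- The closed unit square as a rational rectangle. [folklore] -/
def unitSq : RectQ := ⟨fun _ => 0, fun _ => 1⟩

/-- Membership in the unit square rectangle. [folklore] -/
theorem mem_unitSq_iff (z : E²) : unitSq.mem z ↔ ∀ j, 0 ≤ z j ∧ z j ≤ 1 := by
  simp [RectQ.mem, unitSq]


/-! ### Strips and strip-aware chain covers

A node in gap regimes on its tube rectangle has its band inside a STRIP `lo ≤ a₀ z₀ + a₁ z₁ ≤ hi`;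
only the part of the rectangle inside the strip needs to be covered. Along axis `i` the transverse
extent of `strip ∩ rectangle ∩ {z_i ∈ [a, b]}` is bounded by the transverse extents at `z_i = a`
and `z_i = b` (linear in `z_i`), which gives a finite transverse containment test per rectangle. -/

/-- **Rational strip** `lo ≤ a₀ z₀ + a₁ z₁ ≤ hi`. [folklore] -/
structure StripQ where
  /-- coefficient of `z₀` -/
  a0 : ℚ
  /-- coefficient of `z₁` -/
  a1 : ℚ
  /-- lower level -/
  lo : ℚ
  /-- upper level -/
  hi : ℚ

/-- Membership in a strip. [folklore] -/
def StripQ.mem (T : StripQ) (z : E²) : Prop := (T.lo : ℝ) ≤ (T.a0 : ℝ) * z 0 + (T.a1 : ℝ) * z 1 ∧ (T.a0 : ℝ) * z 0 + (T.a1 : ℝ) * z 1 ≤ T.hi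

/-- The whole plane as a strip. [folklore] -/
def StripQ.univ : StripQ := ⟨0, 0, 0, 0⟩

/-- Every point is in the universal strip. [folklore] -/
theorem StripQ.mem_univ (z : E²) : StripQ.univ.mem z := by simp [StripQ.mem, StripQ.univ]

/-- Coefficient of the strip form along axis `j`. [folklore] -/
def StripQ.coef (T : StripQ) (j : Fin 2) : ℚ := if j = 0 then T.a0 else T.a1

/-- **Transverse bounds of the strip at a given axial coordinate** `x` along axis `i`, intersected
with the transverse range `[tlo, thi]`: if the transverse coefficient vanishes, the range itself. [folklore] -/
def StripQ.tRange (T : StripQ) (i : Fin 2) (tlo thi x : ℚ) : ℚ × ℚ :=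
  let ci := T.coef i
  let ct := T.coef (1 - i)
  if ct = 0 then (tlo, thi)
  else if 0 < ct then (max tlo ((T.lo - ci * x) / ct), min thi ((T.hi - ci * x) / ct))
  else (max tlo ((T.hi - ci * x) / ct), min thi ((T.lo - ci * x) / ct))

/-- The strip form in axis coordinates. [folklore] -/
theorem StripQ.form_eq (T : StripQ) (i : Fin 2) (z : E²) :
    (T.a0 : ℝ) * z 0 + (T.a1 : ℝ) * z 1 = (T.coef i : ℝ) * z i + (T.coef (1 - i) : ℝ) * z (1 - i) := by
  fin_cases i <;> simp [StripQ.coef]; ring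

/-- **Soundness of the transverse bounds**: a strip point of the transverse range at axial
coordinate `x` has its transverse coordinate in `tRange`. [folklore] -/
theorem StripQ.mem_tRange (T : StripQ) (i : Fin 2) {tlo thi x : ℚ} {z : E²} (hz : T.mem z) (hx : z i = (x : ℝ))
    (ht : (tlo : ℝ) ≤ z (1 - i) ∧ z (1 - i) ≤ thi) :
    ((T.tRange i tlo thi x).1 : ℝ) ≤ z (1 - i) ∧ z (1 - i) ≤ ((T.tRange i tlo thi x).2 : ℝ) := by
  obtain ⟨h1, h2⟩ := hz
  rw [T.form_eq i, hx] at h1 h2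
  simp only [StripQ.tRange]
  set ci := T.coef i
  set ct := T.coef (1 - i)
  by_cases h0 : ct = 0
  · simp [h0]; exact ht
  · simp only [h0, ↓reduceIte]
    have hct : (ct : ℝ) ≠ 0 := by exact_mod_cast h0
    by_cases hpos : 0 < ct
    · simp only [hpos, ↓reduceIte]
      have hctR : (0 : ℝ) < ct := by exact_mod_cast hpos
      push_cast
      refine ⟨max_le ht.1 ?_, le_min ht.2 ?_⟩
      · rw [div_le_iff₀ hctR]; linarith
      · rw [le_div_iff₀ hctR]; linarith
    · simp only [hpos, ↓reduceIte]
      have hctR : (ct : ℝ) < 0 := by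
        have : ct < 0 := lt_of_le_of_ne (not_lt.1 hpos) h0
        exact_mod_cast this
      push_cast
      refine ⟨max_le ht.1 ?_, le_min ht.2 ?_⟩
      · rw [div_le_iff_of_neg hctR]; linarith
      · rw [le_div_iff_of_neg hctR]; linarith

/-- A point of a rectangle with transverse range bounded at both axial ends linearly... concretely:
on `[a, e]` the transverse coordinate of a strip point lies between the bounds at `a` and `e`. [folklore] -/
theorem StripQ.mem_between (T : StripQ) (i : Fin 2) {tlo thi a e : ℚ} {z : E²} (hz : T.mem z)
    (ha : (a : ℝ) ≤ z i) (he : z i ≤ (e : ℝ)) (ht : (tlo : ℝ) ≤ z (1 - i) ∧ z (1 - i) ≤ thi) :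
    min ((T.tRange i tlo thi a).1 : ℝ) ((T.tRange i tlo thi e).1 : ℝ) ≤ z (1 - i) ∧
      z (1 - i) ≤ max ((T.tRange i tlo thi a).2 : ℝ) ((T.tRange i tlo thi e).2 : ℝ) := by
  -- the transverse strip bounds are affine in the axial coordinate: interpolate between `a` and `e`
  obtain ⟨h1, h2⟩ := hz
  rw [T.form_eq i] at h1 h2
  simp only [StripQ.tRange]
  set ci := T.coef i
  set ct := T.coef (1 - i)
  by_cases h0 : ct = 0
  · simp [h0]; exact ht
  · simp only [h0, ↓reduceIte]
    have hct : (ct : ℝ) ≠ 0 := by exact_mod_cast h0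
    -- write z_t bounds: ct z_t ∈ [lo - ci z_i, hi - ci z_i]; and ci z_i between ci a, ci e
    have key : ∀ (L : ℝ), (min ((L - ci * a) / ct) ((L - ci * e) / ct) ≤ (L - ci * z i) / ct) ∧
        ((L - ci * z i) / ct ≤ max ((L - ci * a) / ct) ((L - ci * e) / ct)) := by
      intro L
      rcases lt_or_gt_of_ne hct with hneg | hposR
      · rcases le_total 0 (ci : ℝ) with hci | hci
        · constructor
          · refine (min_le_left _ _).trans ?_
            rw [div_le_div_right_of_neg hneg]; nlinarith
          · refine le_trans ?_ (le_max_right _ _)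
            rw [div_le_div_right_of_neg hneg]; nlinarith
        · constructor
          · refine (min_le_right _ _).trans ?_
            rw [div_le_div_right_of_neg hneg]; nlinarith
          · refine le_trans ?_ (le_max_left _ _)
            rw [div_le_div_right_of_neg hneg]; nlinarith
      · rcases le_total 0 (ci : ℝ) with hci | hci
        · constructor
          · refine (min_le_right _ _).trans ?_
            rw [div_le_div_iff_of_pos_right hposR]; nlinarith
          · refine le_trans ?_ (le_max_left _ _)
            rw [div_le_div_iff_of_pos_right hposR]; nlinarith
        · constructor
          · refine (min_le_left _ _).trans ?_
            rw [div_le_div_iff_of_pos_right hposR]; nlinarith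
          · refine le_trans ?_ (le_max_right _ _)
            rw [div_le_div_iff_of_pos_right hposR]; nlinarith
    by_cases hpos : 0 < ct
    · simp only [hpos, ↓reduceIte]
      have hctR : (0 : ℝ) < ct := by exact_mod_cast hpos
      have hzt1 : ((T.lo : ℝ) - ci * z i) / ct ≤ z (1 - i) := by rw [div_le_iff₀ hctR]; linarith
      have hzt2 : z (1 - i) ≤ ((T.hi : ℝ) - ci * z i) / ct := by rw [le_div_iff₀ hctR]; linarith
      push_cast
      constructor
      · have k1 := (key T.lo).1
        have : min (max (tlo : ℝ) ((T.lo - ci * a) / ct)) (max (tlo : ℝ) ((T.lo - ci * e) / ct)) ≤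
            max (tlo : ℝ) (min ((T.lo - ci * a) / ct) ((T.lo - ci * e) / ct)) := by
          rcases le_total ((T.lo - ci * a) / ct : ℝ) ((T.lo - ci * e) / ct) with h | h
          · rw [min_eq_left h]; exact min_le_left _ _
          · rw [min_eq_right h]; exact min_le_right _ _
        exact this.trans (max_le ht.1 (k1.trans hzt1))
      · have k2 := (key T.hi).2
        have : min (thi : ℝ) (max ((T.hi - ci * a) / ct) ((T.hi - ci * e) / ct)) ≤
            max (min (thi : ℝ) ((T.hi - ci * a) / ct)) (min (thi : ℝ) ((T.hi - ci * e) / ct)) := by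
          rcases le_total ((T.hi - ci * a) / ct : ℝ) ((T.hi - ci * e) / ct) with h | h
          · rw [max_eq_right h]; exact le_max_right _ _
          · rw [max_eq_left h]; exact le_max_left _ _
        exact (le_min ht.2 (hzt2.trans k2)).trans this
    · simp only [hpos, ↓reduceIte]
      have hneg : (ct : ℝ) < 0 := by
        have : ct < 0 := lt_of_le_of_ne (not_lt.1 hpos) h0
        exact_mod_cast this
      have hzt1 : ((T.hi : ℝ) - ci * z i) / ct ≤ z (1 - i) := by rw [div_le_iff_of_neg hneg]; linarith
      have hzt2 : z (1 - i) ≤ ((T.lo : ℝ) - ci * z i) / ct := by rw [le_div_iff_of_neg hneg]; linarith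
      push_cast
      constructor
      · have k1 := (key T.hi).1
        have : min (max (tlo : ℝ) ((T.hi - ci * a) / ct)) (max (tlo : ℝ) ((T.hi - ci * e) / ct)) ≤
            max (tlo : ℝ) (min ((T.hi - ci * a) / ct) ((T.hi - ci * e) / ct)) := by
          rcases le_total ((T.hi - ci * a) / ct : ℝ) ((T.hi - ci * e) / ct) with h | h
          · rw [min_eq_left h]; exact min_le_left _ _
          · rw [min_eq_right h]; exact min_le_right _ _
        exact this.trans (max_le ht.1 (k1.trans hzt1))
      · have k2 := (key T.lo).2
        have : min (thi : ℝ) (max ((T.lo - ci * a) / ct) ((T.lo - ci * e) / ct)) ≤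
            max (min (thi : ℝ) ((T.lo - ci * a) / ct)) (min (thi : ℝ) ((T.lo - ci * e) / ct)) := by
          rcases le_total ((T.lo - ci * a) / ct : ℝ) ((T.lo - ci * e) / ct) with h | h
          · rw [max_eq_right h]; exact le_max_right _ _
          · rw [max_eq_left h]; exact le_max_left _ _
        exact (le_min ht.2 (hzt2.trans k2)).trans this

/-! ### Two strips: the band slab of a piece and its abscissa interval -/

/-- Determinant of the two strip forms. [folklore] -/
def det2 (T₁ T₂ : StripQ) : ℚ := T₁.a0 * T₂.a1 - T₁.a1 * T₂.a0

/-- Coefficients `(α, β)` with `z_j = α p + β q` when `p, q` are the two strip forms of `z`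
(`det2 ≠ 0`). [folklore] -/
def invCoef (T₁ T₂ : StripQ) (j : Fin 2) : ℚ × ℚ :=
  let d := det2 T₁ T₂
  if j = 0 then (T₂.a1 / d, -T₁.a1 / d) else (-T₂.a0 / d, T₁.a0 / d)

/-- **Range of a coordinate over the parallelogram** `T₁ ∩ T₂` (corner values). [folklore] -/
def paraRange (T₁ T₂ : StripQ) (j : Fin 2) : ℚ × ℚ :=
  let c := invCoef T₁ T₂ j
  let v1 := c.1 * T₁.lo + c.2 * T₂.lo
  let v2 := c.1 * T₁.lo + c.2 * T₂.hi
  let v3 := c.1 * T₁.hi + c.2 * T₂.lo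
  let v4 := c.1 * T₁.hi + c.2 * T₂.hi
  (min (min v1 v2) (min v3 v4), max (max v1 v2) (max v3 v4))

/-- Inversion of the two strip forms. [folklore] -/
theorem coord_eq_invCoef (T₁ T₂ : StripQ) (hd : det2 T₁ T₂ ≠ 0) (j : Fin 2) (z : E²) :
    z j = ((invCoef T₁ T₂ j).1 : ℝ) * ((T₁.a0 : ℝ) * z 0 + (T₁.a1 : ℝ) * z 1) +
      ((invCoef T₁ T₂ j).2 : ℝ) * ((T₂.a0 : ℝ) * z 0 + (T₂.a1 : ℝ) * z 1) := by
  have hdR : (det2 T₁ T₂ : ℝ) ≠ 0 := by exact_mod_cast hd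
  unfold det2 at hdR; push_cast at hdR
  have key : ∀ j : Fin 2, (det2 T₁ T₂ : ℝ) * z j =
      (if j = 0 then (T₂.a1 : ℝ) else -(T₂.a0 : ℝ)) * ((T₁.a0 : ℝ) * z 0 + (T₁.a1 : ℝ) * z 1) +
        (if j = 0 then -(T₁.a1 : ℝ) else (T₁.a0 : ℝ)) * ((T₂.a0 : ℝ) * z 0 + (T₂.a1 : ℝ) * z 1) := by
    intro j; fin_cases j <;> simp [det2] <;> ring
  have hk := key j
  have e1 : ((invCoef T₁ T₂ j).1 : ℝ) = (if j = 0 then (T₂.a1 : ℝ) else -(T₂.a0 : ℝ)) / det2 T₁ T₂ := by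
    fin_cases j <;> simp [invCoef]
  have e2 : ((invCoef T₁ T₂ j).2 : ℝ) = (if j = 0 then -(T₁.a1 : ℝ) else (T₁.a0 : ℝ)) / det2 T₁ T₂ := by
    fin_cases j <;> simp [invCoef]
  have hD : (det2 T₁ T₂ : ℝ) ≠ 0 := by unfold det2; push_cast; exact hdR
  rw [e1, e2, div_mul_eq_mul_div, div_mul_eq_mul_div, ← add_div, ← hk, mul_comm, mul_div_assoc, div_self hD, mul_one]

/-- **A point of both strips has each coordinate in the parallelogram range.** [folklore] -/
theorem mem_paraRange (T₁ T₂ : StripQ) (hd : det2 T₁ T₂ ≠ 0) (j : Fin 2) {z : E²} (h₁ : T₁.mem z) (h₂ : T₂.mem z) :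
    ((paraRange T₁ T₂ j).1 : ℝ) ≤ z j ∧ z j ≤ ((paraRange T₁ T₂ j).2 : ℝ) := by
  rw [coord_eq_invCoef T₁ T₂ hd j z]
  set p := (T₁.a0 : ℝ) * z 0 + (T₁.a1 : ℝ) * z 1
  set q := (T₂.a0 : ℝ) * z 0 + (T₂.a1 : ℝ) * z 1
  set α := ((invCoef T₁ T₂ j).1 : ℝ)
  set β := ((invCoef T₁ T₂ j).2 : ℝ)
  have key := linear_mem_of_corners (a := α) (b := β) (lo := min (min (α * T₁.lo + β * T₂.lo) (α * T₁.lo + β * T₂.hi))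
      (min (α * T₁.hi + β * T₂.lo) (α * T₁.hi + β * T₂.hi)))
    (hi := max (max (α * T₁.lo + β * T₂.lo) (α * T₁.lo + β * T₂.hi)) (max (α * T₁.hi + β * T₂.lo) (α * T₁.hi + β * T₂.hi)))
    h₁ h₂ ⟨(min_le_left _ _).trans (min_le_left _ _), (le_max_left _ _).trans (le_max_left _ _)⟩
    ⟨(min_le_left _ _).trans (min_le_right _ _), (le_max_right _ _).trans (le_max_left _ _)⟩
    ⟨(min_le_right _ _).trans (min_le_left _ _), (le_max_left _ _).trans (le_max_right _ _)⟩
    ⟨(min_le_right _ _).trans (min_le_right _ _), (le_max_right _ _).trans (le_max_right _ _)⟩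
  simp only [paraRange]; push_cast
  exact key

/-- Lower transverse bound of `R ∩ T₁ ∩ T₂` valid on the axial interval `[a, e]`. [folklore] -/
def lo2 (T₁ T₂ : StripQ) (i : Fin 2) (tlo thi a e : ℚ) : ℚ :=
  let l := max (min (T₁.tRange i tlo thi a).1 (T₁.tRange i tlo thi e).1) (min (T₂.tRange i tlo thi a).1 (T₂.tRange i tlo thi e).1)
  if det2 T₁ T₂ = 0 then l else max l (paraRange T₁ T₂ (1 - i)).1

/-- Upper transverse bound. [folklore] -/
def hi2 (T₁ T₂ : StripQ) (i : Fin 2) (tlo thi a e : ℚ) : ℚ :=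
  let h := min (max (T₁.tRange i tlo thi a).2 (T₁.tRange i tlo thi e).2) (max (T₂.tRange i tlo thi a).2 (T₂.tRange i tlo thi e).2)
  if det2 T₁ T₂ = 0 then h else min h (paraRange T₁ T₂ (1 - i)).2

/-- Soundness of the two-strip transverse bounds. [folklore] -/
theorem mem_lo2_hi2 (T₁ T₂ : StripQ) (i : Fin 2) {tlo thi a e : ℚ} {z : E²} (h₁ : T₁.mem z) (h₂ : T₂.mem z)
    (ha : (a : ℝ) ≤ z i) (he : z i ≤ (e : ℝ)) (ht : (tlo : ℝ) ≤ z (1 - i) ∧ z (1 - i) ≤ thi) :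
    (lo2 T₁ T₂ i tlo thi a e : ℝ) ≤ z (1 - i) ∧ z (1 - i) ≤ (hi2 T₁ T₂ i tlo thi a e : ℝ) := by
  have b₁ := StripQ.mem_between T₁ i h₁ ha he ht
  have b₂ := StripQ.mem_between T₂ i h₂ ha he ht
  simp only [lo2, hi2]
  by_cases hd : det2 T₁ T₂ = 0
  · simp only [hd, ↓reduceIte]; push_cast
    exact ⟨max_le b₁.1 b₂.1, le_min b₁.2 b₂.2⟩
  · simp only [hd, ↓reduceIte]; push_cast
    have hp := mem_paraRange T₁ T₂ hd (1 - i) h₁ h₂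
    exact ⟨max_le (max_le b₁.1 b₂.1) hp.1, le_min (le_min b₁.2 b₂.2) hp.2⟩

/-- **Axial emptiness test**: a strip with vanishing transverse coefficient whose axial range misses
`[a, e]`. [folklore] -/
def StripQ.axialEmptyB (T : StripQ) (i : Fin 2) (a e : ℚ) : Bool :=
  decide (T.coef (1 - i) = 0) && !decide (T.coef i = 0) &&
    ((decide (0 < T.coef i) && (decide (T.hi < T.coef i * a) || decide (T.coef i * e < T.lo))) ||
      (decide (T.coef i < 0) && (decide (T.hi < T.coef i * e) || decide (T.coef i * a < T.lo))))

/-- Soundness: no strip point has its axial coordinate in `[a, e]`. [folklore] -/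
theorem StripQ.not_mem_of_axialEmptyB (T : StripQ) (i : Fin 2) {a e : ℚ} (h : T.axialEmptyB i a e = true) {z : E²}
    (hz : T.mem z) (ha : (a : ℝ) ≤ z i) (he : z i ≤ (e : ℝ)) : False := by
  obtain ⟨h1, h2⟩ := hz
  rw [T.form_eq i] at h1 h2
  simp only [StripQ.axialEmptyB, Bool.and_eq_true, Bool.or_eq_true, Bool.not_eq_true', decide_eq_true_eq,
    decide_eq_false_iff_not] at h
  obtain ⟨⟨hct, _⟩, hcases⟩ := h
  rw [hct] at h1 h2
  push_cast at h1 h2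
  simp only [zero_mul, add_zero] at h1 h2
  rcases hcases with ⟨hpos, hc⟩ | ⟨hneg, hc⟩
  · have hposR : (0 : ℝ) < T.coef i := by exact_mod_cast hpos
    rcases hc with hc | hc
    · have : (T.hi : ℝ) < T.coef i * a := by exact_mod_cast hc
      nlinarith
    · have : (T.coef i : ℝ) * e < T.lo := by exact_mod_cast hc
      nlinarith
  · have hnegR : (T.coef i : ℝ) < 0 := by exact_mod_cast hneg
    rcases hc with hc | hc
    · have : (T.hi : ℝ) < T.coef i * e := by exact_mod_cast hc
      nlinarith
    · have : (T.coef i : ℝ) * a < T.lo := by exact_mod_cast hc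
      nlinarith

/-- **Emptiness of the two-strip region on an axial sub-interval** (conservative). [folklore] -/
def emptyOnB (T₁ T₂ : StripQ) (i : Fin 2) (tlo thi : ℚ) (a e : ℚ) : Bool :=
  decide (hi2 T₁ T₂ i tlo thi a e < lo2 T₁ T₂ i tlo thi a e) || T₁.axialEmptyB i a e || T₂.axialEmptyB i a e ||
    (!decide (det2 T₁ T₂ = 0) && (decide ((paraRange T₁ T₂ i).2 < a) || decide (e < (paraRange T₁ T₂ i).1)))

/-- Soundness of the emptiness test on an axial sub-interval. [folklore] -/
theorem not_mem_of_emptyOnB {T₁ T₂ : StripQ} {i : Fin 2} {tlo thi a e : ℚ} (h : emptyOnB T₁ T₂ i tlo thi a e = true)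
    {z : E²} (h₁ : T₁.mem z) (h₂ : T₂.mem z) (ha : (a : ℝ) ≤ z i) (he : z i ≤ (e : ℝ))
    (ht : (tlo : ℝ) ≤ z (1 - i) ∧ z (1 - i) ≤ thi) : False := by
  simp only [emptyOnB, Bool.or_eq_true, Bool.and_eq_true, Bool.not_eq_true', decide_eq_true_eq,
    decide_eq_false_iff_not] at h
  rcases h with ((hlt | hE) | hE) | ⟨hd, hE⟩
  · have hb' := mem_lo2_hi2 T₁ T₂ i h₁ h₂ ha he ht
    have : (hi2 T₁ T₂ i tlo thi a e : ℝ) < lo2 T₁ T₂ i tlo thi a e := by exact_mod_cast hlt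
    linarith [hb'.1, hb'.2]
  · exact T₁.not_mem_of_axialEmptyB i hE h₁ ha he
  · exact T₂.not_mem_of_axialEmptyB i hE h₂ ha he
  · have hp := mem_paraRange T₁ T₂ hd i h₁ h₂
    rcases hE with hE | hE
    · have : ((paraRange T₁ T₂ i).2 : ℝ) < a := by exact_mod_cast hE
      linarith [hp.2]
    · have : (e : ℝ) < (paraRange T₁ T₂ i).1 := by exact_mod_cast hE
      linarith [hp.1]

/-- **Two-strip chain cover test** along axis `i`: each rectangle starts at the current abscissa `a`
(or after an empty stretch `[a, S.lo i]`), and contains the region transversally on its sub-interval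
unless the region is empty there. [folklore] -/
def chainCovers2Aux (T₁ T₂ : StripQ) (i : Fin 2) (tlo thi : ℚ) (a b : ℚ) : List RectQ → Bool
  | [] => emptyOnB T₁ T₂ i tlo thi a b
  | S :: rest =>
    let a₁ := max a (S.lo i)
    let e := min b (S.hi i)
    ((decide (S.lo i ≤ a) || emptyOnB T₁ T₂ i tlo thi a (S.lo i)) && decide (a₁ ≤ e) &&
      (emptyOnB T₁ T₂ i tlo thi a₁ e ||
        (decide (S.lo (1 - i) ≤ lo2 T₁ T₂ i tlo thi a₁ e) && decide (hi2 T₁ T₂ i tlo thi a₁ e ≤ S.hi (1 - i)))) &&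
      (decide (b ≤ S.hi i) || chainCovers2Aux T₁ T₂ i tlo thi (S.hi i) b rest)) ||
    -- or skip `S`
    chainCovers2Aux T₁ T₂ i tlo thi a b rest

/-- **Two-strip chain cover test** of `R ∩ T₁ ∩ T₂` by `Rs` (empty region: trivially covered). [folklore] -/
def chainCovers2B (R : RectQ) (T₁ T₂ : StripQ) (i : Fin 2) (Rs : List RectQ) : Bool :=
  R.isEmptyB || emptyOnB T₁ T₂ i (R.lo (1 - i)) (R.hi (1 - i)) (R.lo i) (R.hi i) ||
    chainCovers2Aux T₁ T₂ i (R.lo (1 - i)) (R.hi (1 - i)) (R.lo i) (R.hi i) Rs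

/-- Soundness of the two-strip auxiliary cover. [folklore] -/
theorem exists_mem_of_chainCovers2Aux (T₁ T₂ : StripQ) (i : Fin 2) (tlo thi : ℚ) :
    ∀ (Rs : List RectQ) (a b : ℚ), chainCovers2Aux T₁ T₂ i tlo thi a b Rs = true →
      ∀ z : E², T₁.mem z → T₂.mem z → (a : ℝ) ≤ z i → z i ≤ (b : ℝ) → (tlo : ℝ) ≤ z (1 - i) → z (1 - i) ≤ (thi : ℝ) →
        ∃ S ∈ Rs, S.mem z := by
  intro Rs
  induction Rs with
  | nil =>
    intro a b h z h₁ h₂ ha hb htlo hthi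
    exact (not_mem_of_emptyOnB h h₁ h₂ ha hb ⟨htlo, hthi⟩).elim
  | cons S rest ih =>
    intro a b h z h₁ h₂ ha hb htlo hthi
    simp only [chainCovers2Aux, Bool.and_eq_true, Bool.or_eq_true, decide_eq_true_eq] at h
    rcases h with h | hskip
    swap
    · obtain ⟨S', hS', hmem⟩ := ih a b hskip z h₁ h₂ ha hb htlo hthi
      exact ⟨S', by simp [hS'], hmem⟩
    obtain ⟨⟨⟨hS1, h12⟩, hS23⟩, h6⟩ := h
    -- the point is not in the (empty) stretch before `S`
    have ha₁ : ((max a (S.lo i) : ℚ) : ℝ) ≤ z i := by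
      rcases hS1 with hle | hE
      · rw [max_eq_left hle]; exact ha
      · by_contra hc; push Not at hc
        push_cast at hc
        exact not_mem_of_emptyOnB hE h₁ h₂ ha ((lt_max_iff.1 hc).resolve_left (not_lt.2 ha)).le ⟨htlo, hthi⟩
    by_cases hzS : z i ≤ (min b (S.hi i) : ℚ)
    · have hb' := mem_lo2_hi2 T₁ T₂ i h₁ h₂ ha₁ (by exact_mod_cast hzS) ⟨htlo, hthi⟩
      have hS23' : S.lo (1 - i) ≤ lo2 T₁ T₂ i tlo thi (max a (S.lo i)) (min b (S.hi i)) ∧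
          hi2 T₁ T₂ i tlo thi (max a (S.lo i)) (min b (S.hi i)) ≤ S.hi (1 - i) := by
        rcases hS23 with hE | h
        · exact (not_mem_of_emptyOnB hE h₁ h₂ ha₁ (by exact_mod_cast hzS) ⟨htlo, hthi⟩).elim
        · exact h
      obtain ⟨hS2, hS3⟩ := hS23'
      refine ⟨S, by simp, fun j => ?_⟩
      by_cases hj : j = i
      · subst hj
        refine ⟨le_trans (by push_cast; exact le_max_right _ _) ha₁, ?_⟩
        have : ((min b (S.hi j) : ℚ) : ℝ) ≤ S.hi j := by exact_mod_cast min_le_right _ _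
        exact hzS.trans this
      · have hj' : j = 1 - i := by fin_cases i <;> fin_cases j <;> simp_all
        subst hj'
        have hS2' : (S.lo (1 - i) : ℝ) ≤ (lo2 T₁ T₂ i tlo thi (max a (S.lo i)) (min b (S.hi i)) : ℝ) := by exact_mod_cast hS2
        have hS3' : (hi2 T₁ T₂ i tlo thi (max a (S.lo i)) (min b (S.hi i)) : ℝ) ≤ (S.hi (1 - i) : ℝ) := by exact_mod_cast hS3
        exact ⟨hS2'.trans hb'.1, hb'.2.trans hS3'⟩
    · push Not at hzS
      have hShi : (S.hi i : ℝ) < z i := by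
        have hm : (min b (S.hi i) : ℚ) = S.hi i := by
          apply min_eq_right
          by_contra hc; push Not at hc
          have : (min b (S.hi i) : ℚ) = b := min_eq_left hc.le
          rw [this] at hzS; exact absurd hb (not_le.2 hzS)
        rw [hm] at hzS; exact hzS
      rcases h6 with h6 | h6
      · have : (b : ℝ) ≤ S.hi i := by exact_mod_cast h6
        linarith
      · obtain ⟨S', hS', hmem⟩ := ih (S.hi i) b h6 z h₁ h₂ hShi.le hb htlo hthi
        exact ⟨S', by simp [hS'], hmem⟩

/-- **Soundness of the two-strip chain cover.** [folklore] -/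
theorem exists_mem_of_chainCovers2B {R : RectQ} {T₁ T₂ : StripQ} {i : Fin 2} {Rs : List RectQ}
    (h : R.chainCovers2B T₁ T₂ i Rs = true) {z : E²} (hz : R.mem z) (h₁ : T₁.mem z) (h₂ : T₂.mem z) : ∃ S ∈ Rs, S.mem z := by
  simp only [chainCovers2B, Bool.or_eq_true] at h
  rcases h with (h | h) | h
  · exact absurd hz (not_mem_of_isEmptyB h z)
  · exact (not_mem_of_emptyOnB h h₁ h₂ (hz i).1 (hz i).2 ⟨(hz (1 - i)).1, (hz (1 - i)).2⟩).elim
  · exact exists_mem_of_chainCovers2Aux T₁ T₂ i _ _ Rs _ _ h z h₁ h₂ (hz i).1 (hz i).2 (hz (1 - i)).1 (hz (1 - i)).2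

end RectQ

namespace ElemQ

/-- **Range of the abscissa of an element over a rectangle** contained in `[ua, ub]` (corner test). [folklore] -/
def uCornerQ (e₁ : ElemQ) (x y : ℚ) : ℚ := (e₁.uC.1 : ℚ) * x + (e₁.uC.2 : ℚ) * y

/-- One corner test. [folklore] -/
def uCornerInB (e₁ : ElemQ) (x y ua ub : ℚ) : Bool := decide (ua ≤ e₁.uCornerQ x y) && decide (e₁.uCornerQ x y ≤ ub)

/-- Soundness of one corner test. [folklore] -/
theorem corner_of_uCornerInB {e₁ : ElemQ} {x y ua ub : ℚ} (h : e₁.uCornerInB x y ua ub = true) :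
    (ua : ℝ) ≤ (e₁.uC.1 : ℝ) * (x : ℝ) + (e₁.uC.2 : ℝ) * (y : ℝ) ∧ (e₁.uC.1 : ℝ) * (x : ℝ) + (e₁.uC.2 : ℝ) * (y : ℝ) ≤ ub := by
  simp only [uCornerInB, uCornerQ, Bool.and_eq_true, decide_eq_true_eq] at h
  obtain ⟨h1, h2⟩ := h
  constructor
  · have := (Rat.cast_le (K := ℝ)).2 h1; push_cast at this; exact this
  · have := (Rat.cast_le (K := ℝ)).2 h2; push_cast at this; exact this

/-- **Range of the abscissa of an element over a rectangle** contained in `[ua, ub]` (the four corner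
tests). [folklore] -/
def uRangeInB (e₁ : ElemQ) (R : RectQ) (ua ub : ℚ) : Bool :=
  e₁.uCornerInB (R.lo 0) (R.lo 1) ua ub && e₁.uCornerInB (R.lo 0) (R.hi 1) ua ub &&
    e₁.uCornerInB (R.hi 0) (R.lo 1) ua ub && e₁.uCornerInB (R.hi 0) (R.hi 1) ua ub

/-- **Soundness of the abscissa range test.** [folklore] -/
theorem uOf_mem_of_uRangeInB {e₁ : ElemQ} {R : RectQ} {ua ub : ℚ} (h : e₁.uRangeInB R ua ub = true)
    {z : E²} (hz : R.mem z) : (ua : ℝ) ≤ e₁.uOf z ∧ e₁.uOf z ≤ ub := by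
  simp only [uRangeInB, Bool.and_eq_true] at h
  obtain ⟨⟨⟨h1, h2⟩, h3⟩, h4⟩ := h
  simp only [ElemQ.uOf]
  exact linear_mem_of_corners (hz 0) (hz 1) (corner_of_uCornerInB h1) (corner_of_uCornerInB h2) (corner_of_uCornerInB h3)
    (corner_of_uCornerInB h4)

/-! ### Piece strips: where the band of a node can be, piece by piece

By `exists_piece` / `band_chart_form` every band point of a checked node inside its support box
lies, for some annotated piece `π`, at an abscissa in `[π.ua, π.ub]` and with
`v - W u - C ∈ [lo - r₀ B, hi + r₀ B]` for one of the slope bounds `B` of the piece: inside two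
strips with rational data at a frozen instant. -/

/-- The largest slope bound of a piece at an end. [folklore] -/
def xiHiMax (e₁ : ElemQ) (ms : List ℕ) (b : Bool) : ℚ := ((e₁.xiHis ms).map fun B => B.atEnd b).foldr max 0

/-- A member of a list is below the fold of `max`. [folklore] -/
theorem atEnd_le_foldr_max (b : Bool) : ∀ (L : List Aff) {B : Aff}, B ∈ L → B.atEnd b ≤ (L.map fun A => A.atEnd b).foldr max 0
  | [], _, hB => by simp at hB
  | A :: L, B, hB => by
    simp only [List.map_cons, List.foldr_cons]
    rcases List.mem_cons.1 hB with rfl | h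
    · exact le_max_left _ _
    · exact (atEnd_le_foldr_max b L h).trans (le_max_right _ _)

/-- Every listed slope bound is below the largest one. [folklore] -/
theorem atEnd_le_xiHiMax (e₁ : ElemQ) (ms : List ℕ) (b : Bool) {B : Aff} (hB : B ∈ e₁.xiHis ms) : B.atEnd b ≤ e₁.xiHiMax ms b :=
  atEnd_le_foldr_max b _ hB

/-- **Band strip of a piece at an end** (`none` if the slab data are undefined). [folklore] -/
def pieceStripO (e₁ : ElemQ) (π : PieceQ) (r₀ : ℚ) (b : Bool) : Option RectQ.StripQ :=
  match e₁.slabCO π.reg, e₁.slabLoHiO π.reg π.ua π.ub with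
  | some C, some (lo, hi) =>
    let W := (e₁.slabWA π.reg).atEnd b
    let Bm := e₁.xiHiMax π.regXi b
    some ⟨e₁.vC.1 - W * e₁.uC.1, e₁.vC.2 - W * e₁.uC.2, C.atEnd b + lo.atEnd b - r₀ * Bm, C.atEnd b + hi.atEnd b + r₀ * Bm⟩
  | _, _ => none

/-- **Abscissa strip of a piece at an end**: `ua ≤ uC · z ≤ ub`. [folklore] -/
def pieceUStrip (e₁ : ElemQ) (π : PieceQ) (b : Bool) : RectQ.StripQ := ⟨e₁.uC.1, e₁.uC.2, π.ua.atEnd b, π.ub.atEnd b⟩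

/-- **A band point of a piece lies in the two strips of the piece** (at an end value of the clock). [folklore] -/
theorem mem_pieceStrips {e₁ : ElemQ} (hv : e₁.validB = true) {t₀ τ : ℝ} {r₀ : ℚ} (hr : 0 ≤ r₀) {b : Bool} {t : ℝ}
    (ht : clock t₀ τ t = endVal b) {z : E²} (hp : (t, z) ∈ e₁.bandT t₀ τ r₀) {π : PieceQ} (hreg : e₁.pieceRegOKB π = true)
    (hu : e₁.uOf z ∈ Icc (π.ua.eval (clock t₀ τ t)) (π.ub.eval (clock t₀ τ t))) {T : RectQ.StripQ}
    (hT : e₁.pieceStripO π r₀ b = some T) : T.mem z ∧ (e₁.pieceUStrip π b).mem z := by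
  simp only [pieceRegOKB, Bool.and_eq_true] at hreg
  have hα : clock t₀ τ t ∈ Icc (0 : ℝ) 1 := clock_mem_Icc t₀ τ t
  unfold pieceStripO at hT
  cases hC : e₁.slabCO π.reg with
  | none => rw [hC] at hT; exact absurd hT (by simp)
  | some C =>
    cases hS : e₁.slabLoHiO π.reg π.ua π.ub with
    | none => rw [hC, hS] at hT; exact absurd hT (by simp)
    | some lh =>
      obtain ⟨lo, hi⟩ := lh
      rw [hC, hS] at hT
      simp only [Option.some.injEq] at hT
      have hregR := e₁.regOK_of_regOKB hreg.1 hα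
      have h1 := abs_le.1 ((e₁.mem_bandT_iff t₀ τ r₀ (t, z)).1 hp)
      have h2 := e₁.line_sub_mem hv hS hα hregR hu
      obtain ⟨B, hB, hduB⟩ := e₁.exists_xiHi hv hreg.2 hα hu
      have hr' : (0 : ℝ) ≤ r₀ := by exact_mod_cast hr
      have h3 : (r₀ : ℝ) * e₁.xi.du (clock t₀ τ t) (e₁.uOf z) ≤ r₀ * B.eval (clock t₀ τ t) := mul_le_mul_of_nonneg_left hduB hr'
      rw [← e₁.eval_slabCO hC, ← e₁.eval_slabWA, ht] at h2
      rw [ht] at h3 hu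
      simp only [ht] at h1
      simp only [Aff.eval_endVal] at h2 h3 hu
      have hBm : (B.atEnd b : ℝ) ≤ e₁.xiHiMax π.regXi b := by exact_mod_cast e₁.atEnd_le_xiHiMax π.regXi b hB
      subst hT
      simp only [RectQ.StripQ.mem, pieceUStrip]
      have evf : e₁.vOf z = (e₁.vC.1 : ℝ) * z 0 + (e₁.vC.2 : ℝ) * z 1 := rfl
      have euf : e₁.uOf z = (e₁.uC.1 : ℝ) * z 0 + (e₁.uC.2 : ℝ) * z 1 := rfl
      rw [evf, euf] at h1; rw [euf] at h2 hu h3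
      push_cast
      refine ⟨⟨?_, ?_⟩, hu.1, hu.2⟩ <;> nlinarith [h1.1, h1.2, h2.1, h2.2, h3, hBm, hr']

/-- **Cross-multiplied scalar agreement** of two closed forms frozen at their ends (up to sign). [folklore] -/
def crossAgreeB (e₁ : ElemQ) (b₁ : Bool) (mT mΞ : ℕ) (e₂ : ElemQ) (b₂ : Bool) (mT' mΞ' : ℕ) : Bool :=
  decide (frzSmul ((e₂.argDen mΞ').atEnd b₂) ((e₁.argNum mT).frz b₁) =
      frzSmul ((e₁.argDen mΞ).atEnd b₁) ((e₂.argNum mT').frz b₂)) ||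
    decide (frzSmul ((e₂.argDen mΞ').atEnd b₂) ((e₁.argNum mT).frz b₁) =
      frzSmul (-(e₁.argDen mΞ).atEnd b₁) ((e₂.argNum mT').frz b₂))

/-- **Soundness of the cross-multiplied agreement**, given the regimes at the point. [folklore] -/
theorem scalar_eq_of_crossAgreeB {e₁ e₂ : ElemQ} {b₁ b₂ : Bool} {mT mΞ mT' mΞ' : ℕ}
    (h : crossAgreeB e₁ b₁ mT mΞ e₂ b₂ mT' mΞ' = true) (hv₁ : e₁.validB = true) (hv₂ : e₂.validB = true)
    {G : ℝ → ℝ} (hGe : ∀ x, G (-x) = G x) {t₀ τ t₀' τ' t t' : ℝ} (ht : clock t₀ τ t = endVal b₁)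
    (ht' : clock t₀' τ' t' = endVal b₂) {z : E²} (hT₁ : e₁.LineGap mT (endVal b₁) (e₁.uOf z))
    (hΞ₁ : e₁.xi.InGap mΞ (endVal b₁) (e₁.uOf z)) (hm₁ : mΞ ≤ e₁.xi.kinks.length)
    (hT₂ : e₂.LineGap mT' (endVal b₂) (e₂.uOf z)) (hΞ₂ : e₂.xi.InGap mΞ' (endVal b₂) (e₂.uOf z))
    (hm₂ : mΞ' ≤ e₂.xi.kinks.length) : e₁.scalar t₀ τ G t z = e₂.scalar t₀' τ' G t' z := by
  simp only [crossAgreeB, Bool.or_eq_true, decide_eq_true_eq] at h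
  have hα₁ : endVal b₁ ∈ Icc (0 : ℝ) 1 := endVal_mem_Icc b₁
  have hα₂ : endVal b₂ ∈ Icc (0 : ℝ) 1 := endVal_mem_Icc b₂
  rw [e₁.scalar_closed hv₁ G (by rw [ht]; exact hT₁) (by rw [ht]; exact hΞ₁),
    e₂.scalar_closed hv₂ G (by rw [ht']; exact hT₂) (by rw [ht']; exact hΞ₂), ht, ht']
  have hD₁ := e₁.argDen_pos hv₁ hα₁ hm₁
  have hD₂ := e₂.argDen_pos hv₂ hα₂ hm₂
  rw [Poly.eval_endVal] at hD₁ hD₂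
  rw [Lin.eval_endVal, Lin.eval_endVal, Poly.eval_endVal, Poly.eval_endVal]
  rcases h with hsc | hsc
  · have k := congrArg (fun q : ℚ × ℚ × ℚ => ((q.1 : ℝ), (q.2.1 : ℝ), (q.2.2 : ℝ))) hsc
    simp only [frzSmul, Prod.mk.injEq] at k
    push_cast at k
    obtain ⟨k1, k2, k3⟩ := k
    congr 1
    rw [div_eq_div_iff hD₁.ne' hD₂.ne']
    linear_combination k1 + k2 * z 0 + k3 * z 1
  · have k := congrArg (fun q : ℚ × ℚ × ℚ => ((q.1 : ℝ), (q.2.1 : ℝ), (q.2.2 : ℝ))) hsc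
    simp only [frzSmul, Prod.mk.injEq] at k
    push_cast at k
    obtain ⟨k1, k2, k3⟩ := k
    rw [← hGe, ← neg_div]
    congr 1
    rw [div_eq_div_iff hD₁.ne' hD₂.ne']
    linear_combination -(k1 + k2 * z 0 + k3 * z 1)

/-- **A rectangle shrunk by an axis-aligned strip** (unchanged if the strip is not axis-aligned). [folklore] -/
def shrink (R : RectQ) (T : RectQ.StripQ) : RectQ :=
  if T.a1 = 0 ∧ 0 < T.a0 then ⟨fun j => if j = 0 then max (R.lo 0) (T.lo / T.a0) else R.lo j, fun j => if j = 0 then min (R.hi 0) (T.hi / T.a0) else R.hi j⟩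
  else if T.a0 = 0 ∧ 0 < T.a1 then ⟨fun j => if j = 1 then max (R.lo 1) (T.lo / T.a1) else R.lo j, fun j => if j = 1 then min (R.hi 1) (T.hi / T.a1) else R.hi j⟩
  else if T.a1 = 0 ∧ T.a0 < 0 then ⟨fun j => if j = 0 then max (R.lo 0) (T.hi / T.a0) else R.lo j, fun j => if j = 0 then min (R.hi 0) (T.lo / T.a0) else R.hi j⟩
  else if T.a0 = 0 ∧ T.a1 < 0 then ⟨fun j => if j = 1 then max (R.lo 1) (T.hi / T.a1) else R.lo j, fun j => if j = 1 then min (R.hi 1) (T.lo / T.a1) else R.hi j⟩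
  else R

/-- The shrunk rectangle contains every point of `R ∩ T`. [folklore] -/
theorem mem_shrink (R : RectQ) (T : RectQ.StripQ) {z : E²} (hz : R.mem z) (hT : T.mem z) : (shrink R T).mem z := by
  obtain ⟨h1, h2⟩ := hT
  unfold shrink
  split_ifs with c1 c2 c3 c4
  · obtain ⟨ha1, ha0⟩ := c1
    have ha0R : (0 : ℝ) < T.a0 := by exact_mod_cast ha0
    rw [ha1] at h1 h2; push_cast at h1 h2; simp only [zero_mul, add_zero] at h1 h2
    intro j; fin_cases j
    · simp only [Fin.zero_eta, Fin.isValue, ↓reduceIte]; push_cast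
      exact ⟨max_le (hz 0).1 (by rw [div_le_iff₀ ha0R]; linarith), le_min (hz 0).2 (by rw [le_div_iff₀ ha0R]; linarith)⟩
    · simpa using hz 1
  · obtain ⟨ha0, ha1⟩ := c2
    have ha1R : (0 : ℝ) < T.a1 := by exact_mod_cast ha1
    rw [ha0] at h1 h2; push_cast at h1 h2; simp only [zero_mul, zero_add] at h1 h2
    intro j; fin_cases j
    · simpa using hz 0
    · simp only [Fin.mk_one, Fin.isValue, ↓reduceIte]; push_cast
      exact ⟨max_le (hz 1).1 (by rw [div_le_iff₀ ha1R]; linarith), le_min (hz 1).2 (by rw [le_div_iff₀ ha1R]; linarith)⟩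
  · obtain ⟨ha1, ha0⟩ := c3
    have ha0R : (T.a0 : ℝ) < 0 := by exact_mod_cast ha0
    rw [ha1] at h1 h2; push_cast at h1 h2; simp only [zero_mul, add_zero] at h1 h2
    intro j; fin_cases j
    · simp only [Fin.zero_eta, Fin.isValue, ↓reduceIte]; push_cast
      exact ⟨max_le (hz 0).1 (by rw [div_le_iff_of_neg ha0R]; linarith), le_min (hz 0).2 (by rw [le_div_iff_of_neg ha0R]; linarith)⟩
    · simpa using hz 1
  · obtain ⟨ha0, ha1⟩ := c4
    have ha1R : (T.a1 : ℝ) < 0 := by exact_mod_cast ha1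
    rw [ha0] at h1 h2; push_cast at h1 h2; simp only [zero_mul, zero_add] at h1 h2
    intro j; fin_cases j
    · simpa using hz 0
    · simp only [Fin.mk_one, Fin.isValue, ↓reduceIte]; push_cast
      exact ⟨max_le (hz 1).1 (by rw [div_le_iff_of_neg ha1R]; linarith), le_min (hz 1).2 (by rw [le_div_iff_of_neg ha1R]; linarith)⟩
  · exact hz

/-- **Abscissa range of the covering element on a piece region** inside `[ua', ub']`: if the two
abscissa forms are equal or opposite, the piece interval itself (resp. its negative); otherwise the
corner test on the rectangle shrunk by the (axis-aligned) band strip of the piece. [folklore] -/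
def uRangeOnPieceB (e₁ : ElemQ) (π : PieceQ) (b₁ : Bool) (e₂ : ElemQ) (R : RectQ) (T : RectQ.StripQ) (ua' ub' : ℚ) : Bool :=
  if e₂.uC = e₁.uC then decide (ua' ≤ π.ua.atEnd b₁) && decide (π.ub.atEnd b₁ ≤ ub')
  else if e₂.uC = (-e₁.uC.1, -e₁.uC.2) then decide (ua' ≤ -π.ub.atEnd b₁) && decide (-π.ua.atEnd b₁ ≤ ub')
  else e₂.uRangeInB (shrink R T) ua' ub'

/-- **Soundness of the abscissa range test on a piece region.** [folklore] -/
theorem uOf_mem_of_uRangeOnPieceB {e₁ e₂ : ElemQ} {π : PieceQ} {b₁ : Bool} {R : RectQ} {T : RectQ.StripQ} {ua' ub' : ℚ}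
    (h : uRangeOnPieceB e₁ π b₁ e₂ R T ua' ub' = true) {z : E²} (hz : R.mem z) (hT : T.mem z)
    (hu : (π.ua.atEnd b₁ : ℝ) ≤ e₁.uOf z ∧ e₁.uOf z ≤ π.ub.atEnd b₁) : (ua' : ℝ) ≤ e₂.uOf z ∧ e₂.uOf z ≤ ub' := by
  unfold uRangeOnPieceB at h
  split_ifs at h with c1 c2
  · simp only [Bool.and_eq_true, decide_eq_true_eq] at h
    have e : e₂.uOf z = e₁.uOf z := by simp only [ElemQ.uOf, c1]
    rw [e]
    exact ⟨le_trans (by exact_mod_cast h.1) hu.1, hu.2.trans (by exact_mod_cast h.2)⟩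
  · simp only [Bool.and_eq_true, decide_eq_true_eq] at h
    have e : e₂.uOf z = -e₁.uOf z := by
      simp only [ElemQ.uOf, c2]; push_cast; ring
    rw [e]
    have h1 : ((ua' : ℚ) : ℝ) ≤ ((-π.ub.atEnd b₁ : ℚ) : ℝ) := by exact_mod_cast h.1
    have h2 : ((-π.ua.atEnd b₁ : ℚ) : ℝ) ≤ ((ub' : ℚ) : ℝ) := by exact_mod_cast h.2
    push_cast at h1 h2
    exact ⟨by linarith [hu.2], by linarith [hu.1]⟩
  · exact uOf_mem_of_uRangeInB h (mem_shrink R T hz hT)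

/-- **Same shape**: same constructor and orientation, frozen-equal line data (`y` for runs, `T` for
diagonal bands); the material profiles unrestricted. [folklore] -/
def sameShapeB : ElemQ → Bool → ElemQ → Bool → Bool
  | run r, e, run r', e' => decide (r.o = r'.o) && decide (r.y.atEnd e = r'.y.atEnd e')
  | dg d, e, dg d', e' => decide (d.o = d'.o) && d.T.sameValB e d'.T e'
  | _, _, _, _ => false

/-- **Scalars of same-shape elements agree where the material slopes agree.** [folklore] -/
theorem scalar_eq_of_sameShapeB {e₁ e₂ : ElemQ} {b₁ b₂ : Bool} (h : sameShapeB e₁ b₁ e₂ b₂ = true) (G : ℝ → ℝ)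
    {t₀ τ t₀' τ' t t' : ℝ} (ht : clock t₀ τ t = endVal b₁) (ht' : clock t₀' τ' t' = endVal b₂) {z : E²}
    (hdu : e₁.xi.du (endVal b₁) (e₁.uOf z) = e₂.xi.du (endVal b₂) (e₂.uOf z)) :
    e₁.scalar t₀ τ G t z = e₂.scalar t₀' τ' G t' z := by
  cases e₁ with
  | run r =>
    cases e₂ with
    | dg d' => simp [sameShapeB] at h
    | run r' =>
      simp only [sameShapeB, Bool.and_eq_true, decide_eq_true_eq] at h
      obtain ⟨ho, hy⟩ := h
      have hy' : r.y.eval (endVal b₁) = r'.y.eval (endVal b₂) := by rw [Aff.eval_endVal, Aff.eval_endVal, hy]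
      have hu : (run r).uOf z = (run r').uOf z := by simp [uOf, uC, ho]
      simp only [xi] at hdu
      rw [hu] at hdu
      simp only [ElemQ.scalar, RunQ.scalar, LinFrame.conjScalar_apply, runScalar_apply, RunQ.yF, Pw.cdu, ht, ht', ho, hy']
      have : (run r').uOf z = ((d4Frame r'.o).app z) 0 := uOf_run r' z
      rw [← this, hdu]
  | dg d =>
    cases e₂ with
    | run r' => simp [sameShapeB] at h
    | dg d' =>
      simp only [sameShapeB, Bool.and_eq_true, decide_eq_true_eq] at h
      obtain ⟨ho, hT⟩ := h
      have hu : (dg d).uOf z = (dg d').uOf z := by simp [uOf, uC, ho]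
      simp only [xi] at hdu
      rw [hu] at hdu
      simp only [ElemQ.scalar, DgQ.scalar, LinFrame.conjScalar_apply, cornerScalar_apply, Pw.cval, Pw.cdu, ht, ht', ho]
      have : (dg d').uOf z = (diagFrame ((d4Frame d'.o).app z)) 0 := uOf_dg d' z
      simp only [diagFrame, vec2_apply_zero] at this
      rw [← this, hdu, Pw.val_eq_of_sameValB hT]

/-- Sign of a Boolean flag: `true ↦ -1`, `false ↦ 1`. [folklore] -/
def bsgn (b : Bool) : ℤ := if b then -1 else 1

/-- **Related run frames**: the frame of the run `e₂` has abscissa `± u` and ordinate `± v` of the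
frame of the run `e₁` (signs `nu`, `nv`; `true` = negated) and the evaluated transverse lines
correspond (`y' = ± y`). The identical frame is `nu = nv = false`; a child element pulled back
through a similarity with a reflection lands in the frame with negated ordinate, a gate stub
re-described from its gate in the frame with negated abscissa. [folklore] -/
def relShapeB : ElemQ → Bool → ElemQ → Bool → Bool → Bool → Bool
  | run r, e, run r', e', nu, nv =>
    decide (d4a r'.o = bsgn nu * d4a r.o) && decide (d4b r'.o = bsgn nu * d4b r.o) &&
      decide (d4c r'.o = bsgn nv * d4c r.o) && decide (d4d r'.o = bsgn nv * d4d r.o) &&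
      decide (r'.y.atEnd e' = bsgn nv * r.y.atEnd e)
  | _, _, _, _, _, _ => false

/-- Related frames have related abscissae: `u₂ = ± u₁`. [folklore] -/
theorem uOf_of_relShapeB {e₁ e₂ : ElemQ} {b₁ b₂ nu nv : Bool} (h : relShapeB e₁ b₁ e₂ b₂ nu nv = true) (z : E²) :
    e₂.uOf z = (bsgn nu : ℝ) * e₁.uOf z := by
  cases e₁ with
  | dg d => simp [relShapeB] at h
  | run r =>
    cases e₂ with
    | dg _ => simp [relShapeB] at h
    | run r' =>
      simp only [relShapeB, Bool.and_eq_true, decide_eq_true_eq] at h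
      obtain ⟨⟨⟨⟨ha, hb⟩, _⟩, _⟩, _⟩ := h
      simp only [uOf, uC, ha, hb]; push_cast; ring

/-- Freezing preserves related frames. [folklore] -/
theorem relShapeB_frz {e₁ e₂ : ElemQ} {b₁ b₂ nu nv : Bool} (h : relShapeB e₁ b₁ e₂ b₂ nu nv = true) :
    relShapeB (e₁.frz b₁) b₁ (e₂.frz b₂) b₂ nu nv = true := by
  cases e₁ with
  | dg d => simp [relShapeB] at h
  | run r =>
    cases e₂ with
    | dg _ => simp [relShapeB] at h
    | run r' =>
      simp only [relShapeB, Bool.and_eq_true, decide_eq_true_eq] at h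
      simp only [relShapeB, frz, Bool.and_eq_true, decide_eq_true_eq]
      refine ⟨h.1, ?_⟩
      cases b₁ <;> cases b₂ <;> simpa [Aff.atEnd, Aff.const] using h.2

/-- **Scalars of runs in related frames agree where the material slopes agree** (even profile).
[folklore] -/
theorem scalar_eq_of_relShapeB {e₁ e₂ : ElemQ} {b₁ b₂ nu nv : Bool} (h : relShapeB e₁ b₁ e₂ b₂ nu nv = true)
    {G : ℝ → ℝ} (hGe : ∀ x, G (-x) = G x) {t₀ τ t₀' τ' t t' : ℝ} (ht : clock t₀ τ t = endVal b₁)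
    (ht' : clock t₀' τ' t' = endVal b₂) {z : E²}
    (hdu : e₁.xi.du (endVal b₁) (e₁.uOf z) = e₂.xi.du (endVal b₂) (e₂.uOf z)) :
    e₁.scalar t₀ τ G t z = e₂.scalar t₀' τ' G t' z := by
  cases e₁ with
  | dg d => simp [relShapeB] at h
  | run r =>
    cases e₂ with
    | dg _ => simp [relShapeB] at h
    | run r' =>
      simp only [relShapeB, Bool.and_eq_true, decide_eq_true_eq] at h
      obtain ⟨⟨⟨⟨_, _⟩, hc⟩, hd⟩, hy⟩ := h
      simp only [xi] at hdu
      rw [uOf_run, uOf_run] at hdu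
      simp only [ElemQ.scalar, RunQ.scalar, LinFrame.conjScalar_apply, runScalar_apply, RunQ.yF, Pw.cdu, ht, ht']
      rw [← hdu]
      have hy' : r'.y.eval (endVal b₂) = (bsgn nv : ℝ) * r.y.eval (endVal b₁) := by
        rw [Aff.eval_endVal, Aff.eval_endVal, hy]; push_cast; ring
      have hv : ((d4Frame r'.o).app z) 1 = (bsgn nv : ℝ) * ((d4Frame r.o).app z) 1 := by
        simp only [LinFrame.app_apply, vec2_apply_one, d4Frame_c, d4Frame_d, hc, hd]; push_cast; ring
      rw [hv, hy']
      cases nv with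
      | false => simp [bsgn]
      | true =>
        simp only [bsgn, if_true, Int.cast_neg, Int.cast_one]
        rw [← hGe]
        congr 1
        ring

/-- **Related-frame local certificate** (runs): as `localXi`, but the covering run is described in a
related frame (`relShapeB` with signs `nu, nv`); for a reversed abscissa the local material data are
mirrored (`Pw.revLocalB`), otherwise equal (`Pw.sameLocalB`). All four sign pairs are tried, so the
certificate carries no sign. [folklore] -/
def relLocalXiB (e₁ : ElemQ) (b₁ : Bool) (π : PieceQ) (T : RectQ.StripQ) (e₂ : ElemQ) (b₂ : Bool) (R : RectQ)
    (mΞ mΞ' : ℕ) (ua' ub' : ℚ) : Bool :=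
  (e₁.frz b₁).validB && (e₂.frz b₂).validB &&
    (e₁.frz b₁).xi.transAtEndB mΞ b₁ (π.ua.atEnd b₁) (π.ub.atEnd b₁) && (e₂.frz b₂).xi.transAtEndB mΞ' b₂ ua' ub' &&
    uRangeOnPieceB e₁ π b₁ e₂ R T ua' ub' &&
    [(false, false), (false, true), (true, false), (true, true)].any fun s =>
      relShapeB e₁ b₁ e₂ b₂ s.1 s.2 &&
        (if s.1 then (e₁.frz b₁).xi.revLocalB mΞ b₁ (e₂.frz b₂).xi mΞ' b₂
         else (e₁.frz b₁).xi.sameLocalB mΞ b₁ (e₂.frz b₂).xi mΞ' b₂)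

/-- **Soundness of the related-frame local certificate.** [folklore] -/
theorem scalar_eq_of_relLocalXiB {e₁ e₂ : ElemQ} {b₁ b₂ : Bool} {π : PieceQ} {T : RectQ.StripQ} {R : RectQ}
    {mΞ mΞ' : ℕ} {ua' ub' : ℚ} (h : relLocalXiB e₁ b₁ π T e₂ b₂ R mΞ mΞ' ua' ub' = true)
    {G : ℝ → ℝ} (hGe : ∀ x, G (-x) = G x) {t₀ τ t₀' τ' t t' : ℝ} (ht : clock t₀ τ t = endVal b₁)
    (ht' : clock t₀' τ' t' = endVal b₂) {z : E²} (hz : R.mem z) (hT : T.mem z)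
    (hu : e₁.uOf z ∈ Icc (π.ua.eval (endVal b₁)) (π.ub.eval (endVal b₁))) :
    e₁.scalar t₀ τ G t z = e₂.scalar t₀' τ' G t' z := by
  simp only [relLocalXiB, Bool.and_eq_true, List.any_eq_true] at h
  obtain ⟨⟨⟨⟨⟨hf₁, hf₂⟩, ht₁⟩, ht₂⟩, hrange⟩, s, _, hs⟩ := h
  obtain ⟨hshape, hloc⟩ := hs
  have hu' : (π.ua.atEnd b₁ : ℝ) ≤ e₁.uOf z ∧ e₁.uOf z ≤ π.ub.atEnd b₁ := by
    simpa only [Aff.eval_endVal] using (show π.ua.eval (endVal b₁) ≤ e₁.uOf z ∧ e₁.uOf z ≤ π.ub.eval (endVal b₁) from hu)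
  have hu₁' : (π.ua.atEnd b₁ : ℝ) ≤ (e₁.frz b₁).uOf z ∧ (e₁.frz b₁).uOf z ≤ π.ub.atEnd b₁ := by
    cases e₁ <;> simpa [frz, uOf, uC] using hu'
  have hu₂ := uOf_mem_of_uRangeOnPieceB hrange hz hT hu'
  have hu₂' : (ua' : ℝ) ≤ (e₂.frz b₂).uOf z ∧ (e₂.frz b₂).uOf z ≤ ub' := by
    cases e₂ <;> simpa [frz, uOf, uC] using hu₂
  have hF₁ : (e₁.frz b₁).xi.LenPos := Pw.lenPos_of_matValidB ((e₁.frz b₁).matValid_of_validB hf₁)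
  have hF₂ : (e₂.frz b₂).xi.LenPos := Pw.lenPos_of_matValidB ((e₂.frz b₂).matValid_of_validB hf₂)
  have hshape' := relShapeB_frz hshape
  have huu : (e₂.frz b₂).uOf z = (bsgn s.1 : ℝ) * (e₁.frz b₁).uOf z := uOf_of_relShapeB hshape' z
  have hdu : (e₁.frz b₁).xi.du (endVal b₁) ((e₁.frz b₁).uOf z) = (e₂.frz b₂).xi.du (endVal b₂) ((e₂.frz b₂).uOf z) := by
    obtain ⟨nu, nv⟩ := s
    cases nu with
    | false =>
      simp only [Bool.false_eq_true, ↓reduceIte] at hloc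
      simp only [bsgn, Bool.false_eq_true, ↓reduceIte, Int.cast_one, one_mul] at huu
      exact Pw.du_eq_of_sameLocalB hloc hF₁ hF₂ huu.symm (Pw.inTrans_of_transAtEndB ht₁ hu₁')
        (Pw.inTrans_of_transAtEndB ht₂ hu₂')
    | true =>
      simp only [↓reduceIte] at hloc
      simp only [bsgn, ↓reduceIte, Int.cast_neg, Int.cast_one, neg_mul, one_mul] at huu
      exact Pw.du_eq_of_revLocalB hloc hF₁ hF₂ huu (Pw.inTrans_of_transAtEndB ht₁ hu₁')
        (Pw.inTrans_of_transAtEndB ht₂ hu₂')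
  rw [← e₁.scalar_frz b₁ G ht z, ← e₂.scalar_frz b₂ G ht' z]
  exact scalar_eq_of_relShapeB hshape' hGe ht ht' hdu

/-- **Certificate check on a piece** `π` of the covered element `e₁` (end `b₁`) against the covering
element `e₂` (end `b₂`), on the rectangle `R` (the intersection of the two tube rectangles) and the
band strip `T` of the piece. [folklore] -/
def certOnPieceB (e₁ : ElemQ) (b₁ : Bool) (π : PieceQ) (T : RectQ.StripQ) (e₂ : ElemQ) (b₂ : Bool) (R : RectQ) :
    EquivCert → Bool
  | .same => equivB e₁ b₁ e₂ b₂
  | .flip => flipB e₁ b₁ e₂ b₂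
  | .gap mT mΞ mT' mΞ' ua' ub' =>
    (e₁.frz b₁).validB && (e₁.frz b₁).gapSideB b₁ mT mΞ (π.ua.atEnd b₁) (π.ub.atEnd b₁) &&
      (e₂.frz b₂).validB && (e₂.frz b₂).gapSideB b₂ mT' mΞ' ua' ub' &&
      crossAgreeB (e₁.frz b₁) b₁ mT mΞ (e₂.frz b₂) b₂ mT' mΞ' && uRangeOnPieceB e₁ π b₁ e₂ R T ua' ub'
  | .localXi mΞ mΞ' ua' ub' =>
    (sameShapeB e₁ b₁ e₂ b₂ && (e₁.frz b₁).validB && (e₂.frz b₂).validB &&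
      (e₁.frz b₁).xi.transAtEndB mΞ b₁ (π.ua.atEnd b₁) (π.ub.atEnd b₁) && (e₂.frz b₂).xi.transAtEndB mΞ' b₂ ua' ub' &&
      (e₁.frz b₁).xi.sameLocalB mΞ b₁ (e₂.frz b₂).xi mΞ' b₂ && uRangeOnPieceB e₁ π b₁ e₂ R T ua' ub') ||
    -- runs in related frames (reflected similarities, gate stubs): NOTES S9.11
    relLocalXiB e₁ b₁ π T e₂ b₂ R mΞ mΞ' ua' ub'

/-- **Soundness of a certificate on a piece**: at a point of `R ∩ T` whose abscissa is in the piece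
(with the piece regime valid at the end value), the two scalars agree. [folklore] -/
theorem scalar_eq_of_certOnPieceB {e₁ e₂ : ElemQ} {b₁ b₂ : Bool} {π : PieceQ} {T : RectQ.StripQ} {R : RectQ} {c : EquivCert}
    (h : certOnPieceB e₁ b₁ π T e₂ b₂ R c = true)
    {G : ℝ → ℝ} (hGe : ∀ x, G (-x) = G x) {t₀ τ t₀' τ' t t' : ℝ} (ht : clock t₀ τ t = endVal b₁)
    (ht' : clock t₀' τ' t' = endVal b₂) {z : E²} (hz : R.mem z) (hT : T.mem z)
    (hu : e₁.uOf z ∈ Icc (π.ua.eval (endVal b₁)) (π.ub.eval (endVal b₁))) :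
    e₁.scalar t₀ τ G t z = e₂.scalar t₀' τ' G t' z := by
  cases c with
  | same => exact scalar_eq_of_equivB h G ht ht' z
  | flip => exact scalar_eq_of_flipB h hGe ht ht' z
  | gap mT mΞ mT' mΞ' ua' ub' =>
    simp only [certOnPieceB, Bool.and_eq_true] at h
    obtain ⟨⟨⟨⟨⟨hf₁, hs₁⟩, hf₂⟩, hs₂⟩, hcross⟩, hrange⟩ := h
    have hu' : (π.ua.atEnd b₁ : ℝ) ≤ e₁.uOf z ∧ e₁.uOf z ≤ π.ub.atEnd b₁ := by
      simpa only [Aff.eval_endVal] using (show π.ua.eval (endVal b₁) ≤ e₁.uOf z ∧ e₁.uOf z ≤ π.ub.eval (endVal b₁) from hu)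
    have hu₁' : (π.ua.atEnd b₁ : ℝ) ≤ (e₁.frz b₁).uOf z ∧ (e₁.frz b₁).uOf z ≤ π.ub.atEnd b₁ := by
      cases e₁ <;> simpa [frz, uOf, uC] using hu'
    have hu₂ := uOf_mem_of_uRangeOnPieceB hrange hz hT hu'
    have hu₂' : (ua' : ℝ) ≤ (e₂.frz b₂).uOf z ∧ (e₂.frz b₂).uOf z ≤ ub' := by
      cases e₂ <;> simpa [frz, uOf, uC] using hu₂
    obtain ⟨hT₁, hΞ₁, hm₁⟩ := gaps_of_gapSideB hs₁ hu₁'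
    obtain ⟨hT₂, hΞ₂, hm₂⟩ := gaps_of_gapSideB hs₂ hu₂'
    rw [← e₁.scalar_frz b₁ G ht z, ← e₂.scalar_frz b₂ G ht' z]
    exact scalar_eq_of_crossAgreeB hcross hf₁ hf₂ hGe ht ht' hT₁ hΞ₁ hm₁ hT₂ hΞ₂ hm₂
  | localXi mΞ mΞ' ua' ub' =>
    simp only [certOnPieceB, Bool.or_eq_true] at h
    rcases h with h | h
    swap
    · exact scalar_eq_of_relLocalXiB h hGe ht ht' hz hT hu
    simp only [Bool.and_eq_true] at h
    obtain ⟨⟨⟨⟨⟨⟨hshape, hf₁⟩, hf₂⟩, ht₁⟩, ht₂⟩, hloc⟩, hrange⟩ := h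
    have hu' : (π.ua.atEnd b₁ : ℝ) ≤ e₁.uOf z ∧ e₁.uOf z ≤ π.ub.atEnd b₁ := by
      simpa only [Aff.eval_endVal] using (show π.ua.eval (endVal b₁) ≤ e₁.uOf z ∧ e₁.uOf z ≤ π.ub.eval (endVal b₁) from hu)
    have hu₁' : (π.ua.atEnd b₁ : ℝ) ≤ (e₁.frz b₁).uOf z ∧ (e₁.frz b₁).uOf z ≤ π.ub.atEnd b₁ := by
      cases e₁ <;> simpa [frz, uOf, uC] using hu'
    have hu₂ := uOf_mem_of_uRangeOnPieceB hrange hz hT hu'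
    have hu₂' : (ua' : ℝ) ≤ (e₂.frz b₂).uOf z ∧ (e₂.frz b₂).uOf z ≤ ub' := by
      cases e₂ <;> simpa [frz, uOf, uC] using hu₂
    have hF₁ : (e₁.frz b₁).xi.LenPos := Pw.lenPos_of_matValidB ((e₁.frz b₁).matValid_of_validB hf₁)
    have hF₂ : (e₂.frz b₂).xi.LenPos := Pw.lenPos_of_matValidB ((e₂.frz b₂).matValid_of_validB hf₂)
    -- same shape survives freezing; in particular the abscissa forms agree
    have hshape' : sameShapeB (e₁.frz b₁) b₁ (e₂.frz b₂) b₂ = true := by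
      cases e₁ with
      | run r =>
        cases e₂ with
        | dg _ => simp [sameShapeB] at hshape
        | run r' =>
          simp only [sameShapeB, Bool.and_eq_true, decide_eq_true_eq] at hshape
          simp only [sameShapeB, frz, Bool.and_eq_true, decide_eq_true_eq]
          exact ⟨hshape.1, by cases b₁ <;> cases b₂ <;> simpa [Aff.atEnd, Aff.const] using hshape.2⟩
      | dg d =>
        cases e₂ with
        | run _ => simp [sameShapeB] at hshape
        | dg d' =>
          simp only [sameShapeB, Bool.and_eq_true, decide_eq_true_eq] at hshape
          simp only [sameShapeB, frz, Bool.and_eq_true, decide_eq_true_eq]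
          exact ⟨hshape.1, Pw.sameValB_frzPw_frzPw hshape.2⟩
    have huu : (e₁.frz b₁).uOf z = (e₂.frz b₂).uOf z := by
      cases e₁ with
      | run r =>
        cases e₂ with
        | dg _ => simp [sameShapeB] at hshape
        | run r' =>
          simp only [sameShapeB, Bool.and_eq_true, decide_eq_true_eq] at hshape
          simp [frz, uOf, uC, hshape.1]
      | dg d =>
        cases e₂ with
        | run _ => simp [sameShapeB] at hshape
        | dg d' =>
          simp only [sameShapeB, Bool.and_eq_true, decide_eq_true_eq] at hshape
          simp [frz, uOf, uC, hshape.1]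
    have hdu := Pw.du_eq_of_sameLocalB hloc hF₁ hF₂ huu (Pw.inTrans_of_transAtEndB ht₁ hu₁')
      (Pw.inTrans_of_transAtEndB ht₂ hu₂')
    rw [← e₁.scalar_frz b₁ G ht z, ← e₂.scalar_frz b₂ G ht' z]
    exact scalar_eq_of_sameShapeB hshape' G ht ht' hdu

end ElemQ

/-- **Support rectangle of a box at an end.** [folklore] -/
def BoxQ.suppRect (B : BoxQ) (e : Bool) : RectQ :=
  ⟨fun i => (B.suppLo i).atEnd e, fun i => (B.suppHi i).atEnd e⟩

/-- Membership in the support rectangle is membership in the frozen support box. [folklore] -/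
theorem BoxQ.mem_suppRect_iff (B : BoxQ) (e : Bool) (z : E²) : (B.suppRect e).mem z ↔ z ∈ (B.frzAt (endVal e)).supp := by
  simp only [RectQ.mem, BoxQ.suppRect, Fin.forall_fin_two, BoxQ.suppLo, BoxQ.suppHi, Fin.isValue, if_true,
    one_ne_zero, if_false]
  rw [← Aff.eval_endVal, ← Aff.eval_endVal, ← Aff.eval_endVal, ← Aff.eval_endVal]
  simp only [Aff.eval_add, Aff.eval_sub, Aff.eval_const, BoxQ.frzAt, BoxPlateau.supp, Set.mem_setOf_eq]
  push_cast
  constructor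
  · rintro ⟨⟨h1, h2⟩, h3, h4⟩; exact ⟨by linarith, by linarith, by linarith, by linarith⟩
  · rintro ⟨h1, h2, h3, h4⟩; exact ⟨⟨by linarith, by linarith⟩, by linarith, by linarith⟩

namespace StepQ

/-- **Sign test**: the orientation is `1` or `-1`. [folklore] -/
def sgnOKB (J : StepQ) : Bool := decide (J.sgn = 1) || decide (J.sgn = -1)

/-- Clip a rectangle to `{arg ≥ c}` of a step at an end (`sgn = ±1`, else emptied). [folklore] -/
def clipArgGe (J : StepQ) (e : Bool) (c : ℚ) (R : RectQ) : RectQ :=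
  if J.sgn = 1 then R.clipLo J.axis (J.pos.atEnd e + c * J.len)
  else if J.sgn = -1 then R.clipHi J.axis (J.pos.atEnd e - c * J.len)
  else ⟨fun _ => 1, fun _ => 0⟩

/-- Clip a rectangle to `{arg ≤ c}` of a step at an end. [folklore] -/
def clipArgLe (J : StepQ) (e : Bool) (c : ℚ) (R : RectQ) : RectQ :=
  if J.sgn = 1 then R.clipHi J.axis (J.pos.atEnd e + c * J.len)
  else if J.sgn = -1 then R.clipLo J.axis (J.pos.atEnd e - c * J.len)
  else ⟨fun _ => 1, fun _ => 0⟩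

/-- The argument of a step at a time where the clock takes an end value. [folklore] -/
theorem arg_endVal (J : StepQ) {t₀ τ t : ℝ} {e : Bool} (ht : clock t₀ τ t = endVal e) (z : E²) :
    (J.toJ t₀ τ).arg t z = (J.sgn : ℝ) * (z J.axis - (J.pos.atEnd e : ℝ)) / (J.len : ℝ) := by
  simp [StepQ.toJ, JStep.arg, ht]

/-- **Soundness of `clipArgGe`**: exact for `sgn = ±1` and positive length. [folklore] -/
theorem mem_clipArgGe_iff (J : StepQ) (hs : J.sgnOKB = true) (hlen : 0 < J.len) {t₀ τ t : ℝ} {e : Bool}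
    (ht : clock t₀ τ t = endVal e) (c : ℚ) (R : RectQ) (z : E²) :
    (J.clipArgGe e c R).mem z ↔ R.mem z ∧ (c : ℝ) ≤ (J.toJ t₀ τ).arg t z := by
  have hlenR : (0 : ℝ) < J.len := by exact_mod_cast hlen
  simp only [sgnOKB, Bool.or_eq_true, decide_eq_true_eq] at hs
  rw [J.arg_endVal ht]
  rcases hs with h1 | h1
  · simp only [clipArgGe, h1, ↓reduceIte, RectQ.mem_clipLo]
    push_cast
    rw [le_div_iff₀ hlenR]; constructor <;> rintro ⟨h, h'⟩ <;> exact ⟨h, by linarith⟩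
  · have h2 : (if J.sgn = 1 then R.clipLo J.axis (J.pos.atEnd e + c * J.len)
        else if J.sgn = -1 then R.clipHi J.axis (J.pos.atEnd e - c * J.len) else ⟨fun _ => 1, fun _ => 0⟩) =
        R.clipHi J.axis (J.pos.atEnd e - c * J.len) := by rw [if_neg (by rw [h1]; norm_num), if_pos h1]
    rw [clipArgGe, h2, RectQ.mem_clipHi, h1]
    push_cast
    rw [le_div_iff₀ hlenR]; constructor <;> rintro ⟨h, h'⟩ <;> exact ⟨h, by linarith⟩

/-- **Soundness of `clipArgLe`.** [folklore] -/
theorem mem_clipArgLe_iff (J : StepQ) (hs : J.sgnOKB = true) (hlen : 0 < J.len) {t₀ τ t : ℝ} {e : Bool}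
    (ht : clock t₀ τ t = endVal e) (c : ℚ) (R : RectQ) (z : E²) :
    (J.clipArgLe e c R).mem z ↔ R.mem z ∧ (J.toJ t₀ τ).arg t z ≤ (c : ℝ) := by
  have hlenR : (0 : ℝ) < J.len := by exact_mod_cast hlen
  simp only [sgnOKB, Bool.or_eq_true, decide_eq_true_eq] at hs
  rw [J.arg_endVal ht]
  rcases hs with h1 | h1
  · simp only [clipArgLe, h1, ↓reduceIte, RectQ.mem_clipHi]
    push_cast
    rw [div_le_iff₀ hlenR]; constructor <;> rintro ⟨h, h'⟩ <;> exact ⟨h, by linarith⟩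
  · have h2 : (if J.sgn = 1 then R.clipHi J.axis (J.pos.atEnd e + c * J.len)
        else if J.sgn = -1 then R.clipLo J.axis (J.pos.atEnd e - c * J.len) else ⟨fun _ => 1, fun _ => 0⟩) =
        R.clipLo J.axis (J.pos.atEnd e - c * J.len) := by rw [if_neg (by rw [h1]; norm_num), if_pos h1]
    rw [clipArgLe, h2, RectQ.mem_clipLo, h1]
    push_cast
    rw [div_le_iff₀ hlenR]; constructor <;> rintro ⟨h, h'⟩ <;> exact ⟨h, by linarith⟩

end StepQ

/-- **Frozen equality of two boxes at two ends.** [folklore] -/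
def BoxQ.frzEqB (B : BoxQ) (e : Bool) (B' : BoxQ) (e' : Bool) : Bool :=
  decide (B.a₀.atEnd e = B'.a₀.atEnd e') && decide (B.b₀.atEnd e = B'.b₀.atEnd e') &&
    decide (B.a₁.atEnd e = B'.a₁.atEnd e') && decide (B.b₁.atEnd e = B'.b₁.atEnd e') && decide (B.ρ = B'.ρ)

/-- **Frozen equality of two steps at two ends.** [folklore] -/
def StepQ.frzEqB (J : StepQ) (e : Bool) (J' : StepQ) (e' : Bool) : Bool :=
  decide (J.axis = J'.axis) && decide (J.sgn = J'.sgn) && decide (J.pos.atEnd e = J'.pos.atEnd e') && decide (J.len = J'.len)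


namespace PhaseQ

variable (P : PhaseQ)

/-- **At a flat clock time the assembled stream function of a phase is `0`.** [folklore] -/
theorem stream_eq_zero_of_clockDeriv {t : ℝ} (h : clockDeriv P.T0 P.Tau t = 0) (z : E²) : P.stream t z = 0 := by
  rw [PhaseQ.stream, assembledStream_apply]
  simp [PhaseQ.H, ElemQ.stream_eq_zero_of_clockDeriv _ h]

/-- **At a flat clock time the assembled velocity of a phase is `0`.** [folklore] -/
theorem velocity_eq_zero_of_clockDeriv {t : ℝ} (h : clockDeriv P.T0 P.Tau t = 0) (z : E²) : P.velocity t z = 0 := by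
  have hfun : P.stream t = fun _ => 0 := funext fun w => P.stream_eq_zero_of_clockDeriv h w
  have hv : P.velocity t z = perpGrad (P.stream t) z := rfl
  rw [hv, hfun, perpGrad_apply]
  simp [vec2]

/-- **Velocities of two phases agree at flat clock times** (both vanish). [folklore] -/
theorem velocity_eq_of_clockDeriv (P P' : PhaseQ) {t : ℝ} (h : clockDeriv P.T0 P.Tau t = 0) (h' : clockDeriv P'.T0 P'.Tau t = 0) :
    P.velocity t = P'.velocity t :=
  funext fun z => by rw [P.velocity_eq_zero_of_clockDeriv h, P'.velocity_eq_zero_of_clockDeriv h']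

/-! ## Junction agreement and pointwise evaluation of the assembled scalar -/

/-- **Junction agreement of the scalars of a phase** (profile `G`): on each cut junction region
intersected with the agreement slab, consecutive element scalars coincide. (Certified by the
agreement checker; a hypothesis here.) [folklore] -/
def JAgree (P : PhaseQ) (G : ℝ → ℝ) : Prop :=
  ∀ k, k + 1 < P.K → ∀ p ∈ P.chain.juncCut k ∩ P.Agree k, P.Θ G (k + 1) p.1 p.2 = P.Θ G k p.1 p.2

variable {P}

/-- A sum over `range K` with all terms but two (distinct) ones zero. [folklore] -/
private theorem sum_range_eq_pair {K a b : ℕ} (hab : a ≠ b) (ha : a < K) (hb : b < K) (f : ℕ → ℝ)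
    (h0 : ∀ j < K, j ≠ a → j ≠ b → f j = 0) : ∑ j ∈ Finset.range K, f j = f a + f b := by
  rw [← Finset.sum_subset (s₁ := {a, b}) (by
      intro j hj; simp only [Finset.mem_insert, Finset.mem_singleton] at hj
      rcases hj with rfl | rfl <;> simpa)
    (by
      intro j hj hjn
      simp only [Finset.mem_insert, Finset.mem_singleton, not_or] at hjn
      exact h0 j (Finset.mem_range.1 hj) hjn.1 hjn.2)]
  rw [Finset.sum_pair hab]

/-- A sum over `range K` with all terms but two consecutive ones zero. [folklore] -/
private theorem sum_range_eq_two {K k : ℕ} (hk : k + 1 < K) (f : ℕ → ℝ) (h0 : ∀ j < K, j ≠ k → j ≠ k + 1 → f j = 0) :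
    ∑ j ∈ Finset.range K, f j = f k + f (k + 1) :=
  sum_range_eq_pair (by omega) (by omega) hk f h0

/-- **On a cut junction with agreement the assembled scalar is the element scalar** (either of
the two). [folklore] -/
theorem scalar_eq_of_juncCut {G : ℝ → ℝ} (hW : P.chain.WFBd P.Band) (hA : P.JAgree G) {k : ℕ} (hk : k + 1 < P.K)
    {t : ℝ} {z : E²} (hp : (t, z) ∈ P.chain.juncCut k ∩ P.Agree k) :
    P.scalar G t z = P.Θ G k t z ∧ P.scalar G t z = P.Θ G (k + 1) t z := by
  have hj := hW.chi_junction hk hp.1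
  have hagree := hA k hk (t, z) hp
  have hsum : P.scalar G t z = P.chain.chi k t z * P.Θ G k t z + P.chain.chi (k + 1) t z * P.Θ G (k + 1) t z := by
    rw [PhaseQ.scalar, assembledScalar_apply]
    exact sum_range_eq_two hk _ fun j hjK h1 h2 => by rw [hj.2 j hjK h1 h2, zero_mul]
  simp only at hagree
  constructor
  · rw [hsum, hagree, ← add_mul, hj.1, one_mul]
  · rw [hsum, hagree, ← add_mul, hj.1, one_mul]

/-- **Pointwise evaluation on the closed square**: at a point of the closed unit square in the
tube box and the band of node `k` of a checked phase with junction agreement, the assembled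
scalar is `Θ_k`. [folklore] -/
theorem scalar_eq_elem {G : ℝ → ℝ} (hg : P.geomB = true) (hsep : P.boxSepB = true) (hA : P.JAgree G)
    {k : ℕ} (hk : k < P.K) {t : ℝ} {z : E²} (hQ : ∀ j, 0 ≤ z j ∧ z j ≤ 1)
    (hp : (t, z) ∈ P.chain.tubeBox k ∩ P.Band k) : P.scalar G t z = P.Θ G k t z := by
  have hW := wfbd_of_geomB hg hsep
  rcases cover_of_geomB hg t hQ hk hp with hc | ⟨hk0, hj⟩ | ⟨hk1, hj⟩
  · exact (hW.move_eq_of_core (Θ := P.Θ G) (H₀ := 0) (H := P.H) hk hc).1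
  · obtain ⟨k', rfl⟩ : ∃ k', k = k' + 1 := ⟨k - 1, by omega⟩
    simp only [Nat.add_sub_cancel] at hj
    exact (scalar_eq_of_juncCut hW hA (by omega) hj).2
  · exact (scalar_eq_of_juncCut hW hA hk1 hj).1

/-- **Off every tube-box-and-band the assembled scalar of a checked phase vanishes.** [folklore] -/
theorem scalar_eq_zero_off {G : ℝ → ℝ} {M : ℝ} (hG : ContDiff ℝ ∞ G) (hM : ∀ q, |G q| ≤ M) (hM0 : 0 ≤ M)
    (hG0 : ∀ q, G q ≠ 0 → |q| < P.r₀) (hg : P.geomB = true) (hsep : P.boxSepB = true) {t : ℝ} {z : E²}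
    (hz : ∀ k < P.K, (t, z) ∉ P.chain.tubeBox k ∩ P.Band k) : P.scalar G t z = 0 := by
  have hv : P.elemsValidB = true := by simp only [geomB, Bool.and_eq_true] at hg; exact hg.1.1
  exact (wfbd_of_geomB hg hsep).scalar_eq_zero_off_tubes (P.facts hG hM hM0 hG0 hv) hz

variable (P)

/-- **Tube rectangle of node `k` at an end**: the support rectangle clipped to `{arg_{k-1} ≥ 1/3}`
(if `k > 0`) and `{arg_k ≤ 2/3}` (if `k + 1 < K`). [folklore] -/
def tubeRect (P : PhaseQ) (k : ℕ) (e : Bool) : RectQ :=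
  let R₀ := (P.node k).box.suppRect e
  let R₁ := if k = 0 then R₀ else (P.node (k - 1)).step.clipArgGe e (1 / 3) R₀
  if k + 1 < P.K then (P.node k).step.clipArgLe e (2 / 3) R₁ else R₁

/-- **All step signs are `±1`.** [folklore] -/
def sgnsOKB (P : PhaseQ) : Bool := P.nodes.all fun n => n.step.sgnOKB

variable {P}

/-- Sign validity of a node's step. [folklore] -/
theorem sgnOKB_node (h : P.sgnsOKB = true) {k : ℕ} (hk : k < P.K) : (P.node k).step.sgnOKB = true :=
  List.all_eq_true.1 h _ (P.node_mem hk)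

/-- **The tube rectangle is the tube box at an end** (positive lengths, signs `±1`). [folklore] -/
theorem mem_tubeRect_iff (hpos : P.allPosB = true) (hs : P.sgnsOKB = true) {k : ℕ} (hk : k < P.K) {e : Bool} {t : ℝ}
    (ht : clock P.T0 P.Tau t = endVal e) (z : E²) : (P.tubeRect k e).mem z ↔ (t, z) ∈ P.chain.tubeBox k := by
  have hsupp : ((P.node k).box.suppRect e).mem z ↔ z ∈ ((P.node k).box.frzAt (clock P.T0 P.Tau t)).supp := by
    rw [ht]; exact (P.node k).box.mem_suppRect_iff e z
  -- the in-clip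
  have hin : (if k = 0 then (P.node k).box.suppRect e else (P.node (k - 1)).step.clipArgGe e (1 / 3) ((P.node k).box.suppRect e)).mem z ↔
      z ∈ ((P.node k).box.frzAt (clock P.T0 P.Tau t)).supp ∧
        (k = 0 ∨ (1 / 3 : ℝ) ≤ ((P.node (k - 1)).step.toJ P.T0 P.Tau).arg t z) := by
    by_cases hk0 : k = 0
    · simp [hk0] at hsupp ⊢; simpa [hk0] using hsupp
    · simp only [hk0, ↓reduceIte, false_or]
      have hlen : 0 < (P.node (k - 1)).step.len := by
        have := List.all_eq_true.1 hpos _ (P.node_mem (k := k - 1) (by omega))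
        simp only [Bool.and_eq_true, decide_eq_true_eq] at this; exact this.2
      rw [(P.node (k - 1)).step.mem_clipArgGe_iff (sgnOKB_node hs (by omega)) hlen ht, hsupp]
      push_cast; rfl
  unfold tubeRect
  simp only []
  by_cases hk1 : k + 1 < P.K
  · simp only [hk1, ↓reduceIte]
    have hlen : 0 < (P.node k).step.len := by
      have := List.all_eq_true.1 hpos _ (P.node_mem hk)
      simp only [Bool.and_eq_true, decide_eq_true_eq] at this; exact this.2
    rw [(P.node k).step.mem_clipArgLe_iff (sgnOKB_node hs hk) hlen ht, hin]
    simp only [MovingChain.tubeBox, ChainData.tubeBox, Set.mem_setOf_eq, Set.mem_inter_iff]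
    push_cast
    constructor
    · rintro ⟨⟨h1, h2⟩, h3⟩; exact ⟨⟨h1, h2⟩, fun _ => h3⟩
    · rintro ⟨⟨h1, h2⟩, h3⟩; exact ⟨⟨h1, h2⟩, h3 hk1⟩
  · simp only [hk1, ↓reduceIte]
    rw [hin]
    simp only [MovingChain.tubeBox, ChainData.tubeBox, Set.mem_setOf_eq, Set.mem_inter_iff]
    constructor
    · rintro ⟨h1, h2⟩; exact ⟨⟨h1, h2⟩, fun h => absurd h hk1⟩
    · rintro ⟨⟨h1, h2⟩, _⟩; exact ⟨h1, h2⟩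

/-! ## The re-description certificate -/

/-- **Cover entry check** for node `k` of `P` (end `e`) against `P'` (end `e'`): the listed nodes of
`P'` exist and, for every annotated band piece `π` of `k`, the tube rectangles of those listed nodes
whose certificate is valid ON THE PIECE (plain, flipped, or gap regimes — the covered side read off
the piece, the covering side frozen, abscissa ranges on the intersection shrunk by the band strip)
chain-cover the part of the tube rectangle of `k` inside the two strips of the piece. [folklore] -/
def coverEntryB (P : PhaseQ) (e : Bool) (P' : PhaseQ) (e' : Bool) (k : ℕ) (entry : Fin 2 × List (ℕ × EquivCert)) : Bool :=
  let R := P.tubeRect k e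
  (entry.2.all fun kc => decide (kc.1 < P'.K)) &&
    (P.node k).ann.pieces.all fun π =>
      match (P.node k).e.pieceStripO π P.r₀ e with
      | none => false
      | some T =>
        let good := entry.2.filter fun kc =>
          ElemQ.certOnPieceB (P.node k).e e π T (P'.node kc.1).e e' (R.inter (P'.tubeRect kc.1 e')) kc.2
        R.chainCovers2B T ((P.node k).e.pieceUStrip π e) entry.1 (good.map fun kc => P'.tubeRect kc.1 e')

/-- **Frozen equality of the end nodes** (gate stubs): the first and last nodes have frozen-equal
boxes, equivalent elements, and the steps entering / leaving them are frozen-equal. [folklore] -/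
def endNodesEqB (P : PhaseQ) (e : Bool) (P' : PhaseQ) (e' : Bool) : Bool :=
  decide (2 ≤ P.K) && decide (2 ≤ P'.K) &&
    (P.node 0).box.frzEqB e (P'.node 0).box e' && ElemQ.equivB (P.node 0).e e (P'.node 0).e e' &&
    (P.node 0).step.frzEqB e (P'.node 0).step e' &&
    (P.node (P.K - 1)).box.frzEqB e (P'.node (P'.K - 1)).box e' &&
    ElemQ.equivB (P.node (P.K - 1)).e e (P'.node (P'.K - 1)).e e' &&
    (P.node (P.K - 2)).step.frzEqB e (P'.node (P'.K - 2)).step e'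

/-- **Middle boxes inside the closed square** at an end. [folklore] -/
def middleInSqB (P : PhaseQ) (e : Bool) : Bool :=
  (List.range P.K).all fun k => decide (k = 0) || decide (k + 1 = P.K) || ((P.node k).box.suppRect e).subsetB RectQ.unitSq

/-- **Re-description certificate** between `P` at end `e` and `P'` at end `e'`: step signs `±1`,
middle boxes inside the closed square, frozen-equal end nodes, and one cover entry per node in
each direction (each listing nodes of the other phase with an equivalence certificate). [folklore] -/
def redescribeB (P : PhaseQ) (e : Bool) (P' : PhaseQ) (e' : Bool) (cert : List (Fin 2 × List (ℕ × EquivCert)))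
    (cert' : List (Fin 2 × List (ℕ × EquivCert))) : Bool :=
  P.sgnsOKB && P'.sgnsOKB && P.middleInSqB e && P'.middleInSqB e' && endNodesEqB P e P' e' &&
    decide (cert.length = P.K) && decide (cert'.length = P'.K) &&
    (List.range P.K).all (fun k => coverEntryB P e P' e' k (cert.getD k (0, []))) &&
    (List.range P'.K).all (fun k' => coverEntryB P' e' P e k' (cert'.getD k' (0, [])))

/-! ## The re-description theorem -/

/-- Profile hypotheses bundled. [folklore] -/
structure ProfileHyp (G : ℝ → ℝ) (M : ℝ) (r₀ : ℚ) : Prop where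
  /-- smooth -/
  smooth : ContDiff ℝ ∞ G
  /-- bounded -/
  bound : ∀ q, |G q| ≤ M
  /-- nonnegative bound -/
  nonneg : 0 ≤ M
  /-- support radius -/
  supp : ∀ q, G q ≠ 0 → |q| < r₀
  /-- even -/
  even : ∀ q, G (-q) = G q

/-- **One direction of the cover**: at a point of the closed square where element `k` of `P` is
active with a nonzero value, `P'` has the same assembled scalar value. [folklore] -/
theorem scalar_eq_of_coverEntry {G : ℝ → ℝ} {M : ℝ} {P' : PhaseQ} (hGP' : ProfileHyp G M P'.r₀)
    (hg : P.geomB = true) (hsep : P.boxSepB = true) (hA : P.JAgree G)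
    (hg' : P'.geomB = true) (hsep' : P'.boxSepB = true) (hA' : P'.JAgree G) (hs : P.sgnsOKB = true) (hs' : P'.sgnsOKB = true)
    {e e' : Bool} {k : ℕ} (hk : k < P.K) {entry : Fin 2 × List (ℕ × EquivCert)} (hc : coverEntryB P e P' e' k entry = true)
    {t t' : ℝ} (ht : clock P.T0 P.Tau t = endVal e) (ht' : clock P'.T0 P'.Tau t' = endVal e')
    {z : E²} (hQ : ∀ j, 0 ≤ z j ∧ z j ≤ 1) (hp : (t, z) ∈ P.chain.tubeBox k ∩ P.Band k) (hne : P.Θ G k t z ≠ 0) :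
    P'.scalar G t' z = P.scalar G t z := by
  have hpos : P.allPosB = true := (geomB_at hg hk).2.1
  simp only [coverEntryB, Bool.and_eq_true, List.all_eq_true, decide_eq_true_eq] at hc
  obtain ⟨hall, hcov⟩ := hc
  have hzR : (P.tubeRect k e).mem z := (mem_tubeRect_iff hpos hs hk ht z).2 hp.1
  have hv : P.elemsValidB = true := (geomB_at hg hk).1
  have hvk := validB_node hv hk
  -- the point lies in an annotated piece of `k`, hence in its two strips, hence in a listed rectangle
  have hpcs : P.piecesB k = true := (geomB_at hg hk).2.2.2.2
  simp only [piecesB, Bool.and_eq_true] at hpcs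
  have hOK := hpcs.1
  have hzsupp : z ∈ ((P.node k).box.frzAt (clock P.T0 P.Tau t)).supp := hp.1.1.1
  obtain ⟨π, hπ, hu, hreg⟩ := (P.node k).e.exists_piece hvk hOK hp.2 hzsupp
  have hcovπ := hcov π hπ
  have hv' : P'.elemsValidB = true := by
    simp only [geomB, Bool.and_eq_true] at hg'; exact hg'.1.1
  -- a listed node with a certificate valid on the piece whose tube rectangle contains the point
  obtain ⟨kc, hk'mem, hcert, hzS⟩ : ∃ kc ∈ entry.2,
      ElemQ.certOnPieceB (P.node k).e e π
        (((P.node k).e.pieceStripO π P.r₀ e).getD RectQ.StripQ.univ) (P'.node kc.1).e e'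
        ((P.tubeRect k e).inter (P'.tubeRect kc.1 e')) kc.2 = true ∧ (P'.tubeRect kc.1 e').mem z := by
    revert hcovπ
    cases hT : (P.node k).e.pieceStripO π P.r₀ e with
    | none => intro h; exact absurd h (by simp)
    | some T =>
      intro h
      have hr0 := (P.node k).e.r0_nonneg_of_piecesOKB hOK
      obtain ⟨hT1, hT2⟩ := ElemQ.mem_pieceStrips hvk hr0 ht hp.2 hreg hu hT
      obtain ⟨S, hS, hzS⟩ := RectQ.exists_mem_of_chainCovers2B h hzR hT1 hT2
      obtain ⟨kc, hkc, rfl⟩ := List.mem_map.1 hS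
      obtain ⟨hmem, hgood⟩ := List.mem_filter.1 hkc
      exact ⟨kc, hmem, by simpa using hgood, hzS⟩
  have hk' : kc.1 < P'.K := hall kc hk'mem
  set k' := kc.1 with hk'def
  have hpos' : P'.allPosB = true := (geomB_at hg' hk').2.1
  have htube' : (t', z) ∈ P'.chain.tubeBox k' := (mem_tubeRect_iff hpos' hs' hk' ht' z).1 hzS
  -- the element scalars agree at the point, hence `Θ'_{k'} ≠ 0` there and the point lies in the band of `k'`
  have huE : (P.node k).e.uOf z ∈ Icc (π.ua.eval (endVal e)) (π.ub.eval (endVal e)) := by rw [← ht]; exact hu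
  have hTmem : (((P.node k).e.pieceStripO π P.r₀ e).getD RectQ.StripQ.univ).mem z := by
    cases hT : (P.node k).e.pieceStripO π P.r₀ e with
    | none => simpa using RectQ.StripQ.mem_univ z
    | some T =>
      have hr0 := (P.node k).e.r0_nonneg_of_piecesOKB hOK
      simpa using (ElemQ.mem_pieceStrips hvk hr0 ht hp.2 hreg hu hT).1
  have helem : P.Θ G k t z = P'.Θ G k' t' z :=
    ElemQ.scalar_eq_of_certOnPieceB hcert hGP'.even ht ht' (RectQ.mem_inter hzR hzS) hTmem huE
  have hband' : (t', z) ∈ P'.Band k' :=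
    (P'.facts hGP'.smooth hGP'.bound hGP'.nonneg hGP'.supp hv').band k' hk' (t', z) (by rw [← helem]; exact hne)
  rw [scalar_eq_elem hg hsep hA hk hQ hp, scalar_eq_elem hg' hsep' hA' hk' hQ ⟨htube', hband'⟩, helem]

/-- **Equality on the closed square** from the two cover directions. [folklore] -/
theorem scalar_eq_of_covers_sq {G : ℝ → ℝ} {M : ℝ} {P' : PhaseQ} (hGP : ProfileHyp G M P.r₀) (hGP' : ProfileHyp G M P'.r₀)
    (hg : P.geomB = true) (hsep : P.boxSepB = true) (hA : P.JAgree G)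
    (hg' : P'.geomB = true) (hsep' : P'.boxSepB = true) (hA' : P'.JAgree G) (hs : P.sgnsOKB = true) (hs' : P'.sgnsOKB = true)
    {e e' : Bool} {cert cert' : List (Fin 2 × List (ℕ × EquivCert))}
    (hc : ∀ k < P.K, coverEntryB P e P' e' k (cert.getD k (0, [])) = true)
    (hc' : ∀ k' < P'.K, coverEntryB P' e' P e k' (cert'.getD k' (0, [])) = true)
    {t t' : ℝ} (ht : clock P.T0 P.Tau t = endVal e) (ht' : clock P'.T0 P'.Tau t' = endVal e')
    {z : E²} (hQ : ∀ j, 0 ≤ z j ∧ z j ≤ 1) : P.scalar G t z = P'.scalar G t' z := by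
  by_cases h1 : ∃ k < P.K, (t, z) ∈ P.chain.tubeBox k ∩ P.Band k ∧ P.Θ G k t z ≠ 0
  · obtain ⟨k, hk, hp, hne⟩ := h1
    exact (scalar_eq_of_coverEntry hGP' hg hsep hA hg' hsep' hA' hs hs' hk (hc k hk) ht ht' hQ hp hne).symm
  · push Not at h1
    -- `P.scalar = 0`: either no active element, or an active one with value `0`
    have hP0 : P.scalar G t z = 0 := by
      by_cases h2 : ∃ k < P.K, (t, z) ∈ P.chain.tubeBox k ∩ P.Band k
      · obtain ⟨k, hk, hp⟩ := h2
        rw [scalar_eq_elem hg hsep hA hk hQ hp]; exact h1 k hk hp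
      · push Not at h2
        exact scalar_eq_zero_off hGP.smooth hGP.bound hGP.nonneg hGP.supp hg hsep h2
    by_cases h3 : ∃ k' < P'.K, (t', z) ∈ P'.chain.tubeBox k' ∩ P'.Band k' ∧ P'.Θ G k' t' z ≠ 0
    · obtain ⟨k', hk', hp', hne'⟩ := h3
      -- then `P` has the same (nonzero) value: contradiction with `hP0` unless equal anyway
      have := scalar_eq_of_coverEntry hGP hg' hsep' hA' hg hsep hA hs' hs hk' (hc' k' hk') ht' ht hQ hp' hne'
      rw [this]
    · push Not at h3
      have hP'0 : P'.scalar G t' z = 0 := by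
        by_cases h4 : ∃ k' < P'.K, (t', z) ∈ P'.chain.tubeBox k' ∩ P'.Band k'
        · obtain ⟨k', hk', hp'⟩ := h4
          rw [scalar_eq_elem hg' hsep' hA' hk' hQ hp']; exact h3 k' hk' hp'
        · push Not at h4
          exact scalar_eq_zero_off hGP'.smooth hGP'.bound hGP'.nonneg hGP'.supp hg' hsep' h4
      rw [hP0, hP'0]

/-! ## Outside the closed square: only the end nodes -/

/-- The frozen box of node `k`. [folklore] -/
theorem frozen_B (t : ℝ) (k : ℕ) : (P.chain.frozen t).B k = (P.node k).box.frzAt (clock P.T0 P.Tau t) := rfl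

/-- **Outside the closed square the assembled scalar is carried by the two end nodes** (middle
boxes inside the square, `K ≥ 2`). [folklore] -/
theorem scalar_eq_ends (hg : P.geomB = true) (hsep : P.boxSepB = true) {e : Bool} (hm : P.middleInSqB e = true) (hK : 2 ≤ P.K)
    (G : ℝ → ℝ) {t : ℝ} (ht : clock P.T0 P.Tau t = endVal e) {z : E²} (hQ : ¬ ∀ j, 0 ≤ z j ∧ z j ≤ 1) :
    P.scalar G t z = P.chain.chi 0 t z * P.Θ G 0 t z + P.chain.chi (P.K - 1) t z * P.Θ G (P.K - 1) t z := by
  have hW := wfbd_of_geomB hg hsep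
  rw [PhaseQ.scalar, assembledScalar_apply]
  refine sum_range_eq_pair (by omega) (by omega) (by omega) _ fun j hj h0 h1 => ?_
  have hin : ((P.node j).box.suppRect e).subsetB RectQ.unitSq = true := by
    have := List.all_eq_true.1 hm j (List.mem_range.2 hj)
    simp only [Bool.or_eq_true, decide_eq_true_eq] at this
    rcases this with (h | h) | h
    · exact absurd h h0
    · exact absurd (by omega : j = P.K - 1) h1
    · exact h
  have hz : z ∉ ((P.chain.box j).frz t).supp := by
    intro hz
    have hz' : ((P.node j).box.suppRect e).mem z := by
      rw [BoxQ.mem_suppRect_iff, ← ht]; exact hz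
    exact hQ ((RectQ.mem_unitSq_iff z).1 (RectQ.mem_of_subsetB hin hz'))
  rw [hW.chi_eq_zero_of_not_mem hj hz, zero_mul]

/-- Frozen boxes of frozen-equal box data coincide. [folklore] -/
theorem _root_.Literature.Analysis.FluidPDE.PlanarKinematics.BoxQ.frzAt_eq_of_frzEqB {B B' : BoxQ} {e e' : Bool}
    (h : B.frzEqB e B' e' = true) : B.frzAt (endVal e) = B'.frzAt (endVal e') := by
  simp only [BoxQ.frzEqB, Bool.and_eq_true, decide_eq_true_eq] at h
  obtain ⟨⟨⟨⟨h1, h2⟩, h3⟩, h4⟩, h5⟩ := h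
  simp [BoxQ.frzAt, h1, h2, h3, h4, h5]

/-- Junction steps of frozen-equal step data coincide at the two times. [folklore] -/
theorem _root_.Literature.Analysis.FluidPDE.PlanarKinematics.StepQ.val_eq_of_frzEqB {J J' : StepQ} {e e' : Bool}
    (h : J.frzEqB e J' e' = true) {t₀ τ t₀' τ' t t' : ℝ} (ht : clock t₀ τ t = endVal e) (ht' : clock t₀' τ' t' = endVal e') (z : E²) :
    (J.toJ t₀ τ).val t z = (J'.toJ t₀' τ').val t' z := by
  simp only [StepQ.frzEqB, Bool.and_eq_true, decide_eq_true_eq] at h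
  obtain ⟨⟨⟨h1, h2⟩, h3⟩, h4⟩ := h
  rw [JStep.val, JStep.val, J.arg_endVal ht, J'.arg_endVal ht', h1, h2, h3, h4]

/-- **The first cut-off of two phases with frozen-equal first nodes coincides.** [folklore] -/
theorem chi_zero_eq {P' : PhaseQ} {e e' : Bool} (hK : 2 ≤ P.K) (hK' : 2 ≤ P'.K)
    (hb : (P.node 0).box.frzEqB e (P'.node 0).box e' = true) (hs : (P.node 0).step.frzEqB e (P'.node 0).step e' = true)
    {t t' : ℝ} (ht : clock P.T0 P.Tau t = endVal e) (ht' : clock P'.T0 P'.Tau t' = endVal e') (z : E²) :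
    P.chain.chi 0 t z = P'.chain.chi 0 t' z := by
  rw [MovingChain.chi_apply, MovingChain.chi_apply, ChainData.chi_apply, ChainData.chi_apply]
  have hB : (P.chain.frozen t).B 0 = (P'.chain.frozen t').B 0 := by
    rw [frozen_B, frozen_B, ht, ht']; exact BoxQ.frzAt_eq_of_frzEqB hb
  have hIn : (P.chain.frozen t).sigmaIn 0 t z = 1 ∧ (P'.chain.frozen t').sigmaIn 0 t' z = 1 := by
    simp [ChainData.sigmaIn]
  have hOut : (P.chain.frozen t).sigmaOut 0 t z = (P'.chain.frozen t').sigmaOut 0 t' z := by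
    simp only [ChainData.sigmaOut]
    have h1 : 0 + 1 < (P.chain.frozen t).K := by show 0 + 1 < P.K; omega
    have h2 : 0 + 1 < (P'.chain.frozen t').K := by show 0 + 1 < P'.K; omega
    rw [if_pos h1, if_pos h2]
    exact StepQ.val_eq_of_frzEqB hs ht ht' z
  rw [hB, hIn.1, hIn.2, hOut]

/-- **The last cut-off of two phases with frozen-equal last nodes coincides.** [folklore] -/
theorem chi_last_eq {P' : PhaseQ} {e e' : Bool} (hK : 2 ≤ P.K) (hK' : 2 ≤ P'.K)
    (hb : (P.node (P.K - 1)).box.frzEqB e (P'.node (P'.K - 1)).box e' = true)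
    (hs : (P.node (P.K - 2)).step.frzEqB e (P'.node (P'.K - 2)).step e' = true)
    {t t' : ℝ} (ht : clock P.T0 P.Tau t = endVal e) (ht' : clock P'.T0 P'.Tau t' = endVal e') (z : E²) :
    P.chain.chi (P.K - 1) t z = P'.chain.chi (P'.K - 1) t' z := by
  rw [MovingChain.chi_apply, MovingChain.chi_apply, ChainData.chi_apply, ChainData.chi_apply]
  have hB : (P.chain.frozen t).B (P.K - 1) = (P'.chain.frozen t').B (P'.K - 1) := by
    rw [frozen_B, frozen_B, ht, ht']; exact BoxQ.frzAt_eq_of_frzEqB hb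
  have hOut : (P.chain.frozen t).sigmaOut (P.K - 1) t z = 0 ∧ (P'.chain.frozen t').sigmaOut (P'.K - 1) t' z = 0 := by
    simp only [ChainData.sigmaOut]
    have h1 : ¬ P.K - 1 + 1 < (P.chain.frozen t).K := by show ¬ P.K - 1 + 1 < P.K; omega
    have h2 : ¬ P'.K - 1 + 1 < (P'.chain.frozen t').K := by show ¬ P'.K - 1 + 1 < P'.K; omega
    rw [if_neg h1, if_neg h2]; exact ⟨rfl, rfl⟩
  have hIn : (P.chain.frozen t).sigmaIn (P.K - 1) t z = (P'.chain.frozen t').sigmaIn (P'.K - 1) t' z := by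
    simp only [ChainData.sigmaIn, ChainData.sigmaOut]
    rw [if_neg (by omega : ¬ P.K - 1 = 0), if_neg (by omega : ¬ P'.K - 1 = 0)]
    have h1 : P.K - 1 - 1 + 1 < (P.chain.frozen t).K := by show P.K - 1 - 1 + 1 < P.K; omega
    have h2 : P'.K - 1 - 1 + 1 < (P'.chain.frozen t').K := by show P'.K - 1 - 1 + 1 < P'.K; omega
    rw [if_pos h1, if_pos h2, show P.K - 1 - 1 = P.K - 2 by omega, show P'.K - 1 - 1 = P'.K - 2 by omega]
    exact StepQ.val_eq_of_frzEqB hs ht ht' z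
  rw [hB, hOut.1, hOut.2, hIn]

/-- **The re-description theorem, scalar part**: two checked phases with junction agreement and a
valid re-description certificate have the same assembled scalar, on the whole plane, at any two
times where their clocks take the certified end values. [folklore] -/
theorem scalar_eq_of_redescribeB {G : ℝ → ℝ} {M : ℝ} {P' : PhaseQ} (hGP : ProfileHyp G M P.r₀) (hGP' : ProfileHyp G M P'.r₀)
    (hg : P.geomB = true) (hsep : P.boxSepB = true) (hA : P.JAgree G)
    (hg' : P'.geomB = true) (hsep' : P'.boxSepB = true) (hA' : P'.JAgree G)
    {e e' : Bool} {cert cert' : List (Fin 2 × List (ℕ × EquivCert))}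
    (hc : redescribeB P e P' e' cert cert' = true) {t t' : ℝ} (ht : clock P.T0 P.Tau t = endVal e) (ht' : clock P'.T0 P'.Tau t' = endVal e') :
    P.scalar G t = P'.scalar G t' := by
  simp only [redescribeB, Bool.and_eq_true, List.all_eq_true, List.mem_range, decide_eq_true_eq] at hc
  obtain ⟨⟨⟨⟨⟨⟨⟨⟨hs, hs'⟩, hm⟩, hm'⟩, hend⟩, _⟩, _⟩, hcov⟩, hcov'⟩ := hc
  funext z
  by_cases hQ : ∀ j, 0 ≤ z j ∧ z j ≤ 1
  · exact scalar_eq_of_covers_sq hGP hGP' hg hsep hA hg' hsep' hA' hs hs' hcov hcov' ht ht' hQ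
  · simp only [endNodesEqB, Bool.and_eq_true, decide_eq_true_eq] at hend
    obtain ⟨⟨⟨⟨⟨⟨⟨hK, hK'⟩, hb0⟩, he0⟩, hs0⟩, hb1⟩, he1⟩, hs1⟩ := hend
    have h0 : P.Θ G 0 t z = P'.Θ G 0 t' z := ElemQ.scalar_eq_of_equivB he0 G ht ht' z
    have h1 : P.Θ G (P.K - 1) t z = P'.Θ G (P'.K - 1) t' z := ElemQ.scalar_eq_of_equivB he1 G ht ht' z
    rw [scalar_eq_ends hg hsep hm hK G ht hQ, scalar_eq_ends hg' hsep' hm' hK' G ht' hQ,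
      chi_zero_eq hK hK' hb0 hs0 ht ht', chi_last_eq hK hK' hb1 hs1 ht ht', h0, h1]

/-- **The re-description theorem on a common flat window**: if moreover both clocks are flat at
`t` (rates `0`) with the certified end values, the velocities agree as well. [folklore] -/
theorem fields_eq_of_redescribeB {G : ℝ → ℝ} {M : ℝ} {P' : PhaseQ} (hGP : ProfileHyp G M P.r₀) (hGP' : ProfileHyp G M P'.r₀)
    (hg : P.geomB = true) (hsep : P.boxSepB = true) (hA : P.JAgree G)
    (hg' : P'.geomB = true) (hsep' : P'.boxSepB = true) (hA' : P'.JAgree G)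
    {e e' : Bool} {cert cert' : List (Fin 2 × List (ℕ × EquivCert))}
    (hc : redescribeB P e P' e' cert cert' = true) {t : ℝ} (ht : clock P.T0 P.Tau t = endVal e) (ht' : clock P'.T0 P'.Tau t = endVal e')
    (hd : clockDeriv P.T0 P.Tau t = 0) (hd' : clockDeriv P'.T0 P'.Tau t = 0) :
    P.scalar G t = P'.scalar G t ∧ P.velocity t = P'.velocity t :=
  ⟨scalar_eq_of_redescribeB hGP hGP' hg hsep hA hg' hsep' hA' hc ht ht', velocity_eq_of_clockDeriv P P' hd hd'⟩

end PhaseQ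

end PlanarKinematics

end Literature.Analysis.FluidPDE
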